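import Literature.MathematicalPhysics.QuantumFieldTheory.Balaban1983to89.B6L2BlockGradDivTermsV1
import Literature.MathematicalPhysics.QuantumFieldTheory.Balaban1983to89.B6L2BlockGlobalNorm

/-!
# `Balaban1983to89.B6Prop25GradGDivDecayTwoScaleV1` — T. Bałaban, *Propagators and renormalization transformations for lattice gauge theories. II*,
# Commun. Math. Phys. **96** (1984) 223–250 [Balaban1984PropagatorsII], PROPOSITION 2.5 p. 246, THE MEMBER `‖ζ∇G∇*J‖` OF (1.114) FOR THE GENUINE
# TWO-SCALE `G = Δ_a⁻¹` OF (2.90), `Λ′ ⊂ T^{(j+1)}` ARBITRARY, for `tsV1` at the paper's scaling — file 28b, the assembly of the last `ℓ²` member of the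
# two-level decay programme (files 23, 24, 25b, 28a)

statement-level skeleton of published theorems with citation tags; proofs where landed; nothing here is a claim about the Yang–Mills mass gap

p. 246 (Proposition 2.5, verbatim): *"The operator G defined by (2.90) … has the representation (2.129) and satisfies all the inequalities
(1.110)–(1.114) of the Proposition 1.2 with a positive constant δ₂ instead of δ₀. This constant depends on d and L only."*  [4] (1.114) p. 36:
*"… ‖ζGJ‖, ‖ζ∇GJ‖, ‖ζG∇*J‖, ‖ζ∇G∇*J‖, ‖ζ∇∇GJ‖, ‖ζG∇*∇*J‖ ≤ O(1)e^{−δ₀|y−y′|}|ζ|‖J‖ (1.114) for supp ζ ⊂ Δ̃(y), supp J ⊂ Δ̃(y′)."*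

WHAT THIS FILE DOES.  §1 the operator identity (file 1's `G_eq_op_V1`, `(I − K₂)* = I − K₂*`, file 6's `G̃_j = (I − H_jQ_j)G^{(w′)}`, file 25b's
`M = G^{(w′)}R₀`, `M* = M`, `w′ = n^{d+1}`), `M := G̃_j + H_jC̃H_j*`:
`∇_λG∇_μ* = ∇_λK₁∇_μ* + (∇_λG^{(w′)}∇_μ* − (∇_λH_jQ_j)(G^{(w′)}∇_μ*) + ∇_λH_jC̃H_j*∇_μ*) − ((∇_λG^{(w′)})R₀)(K₂∇_μ*) − (∇_λK₂*)(M∇_μ*) + (∇_λK₂*)(M(K₂∇_μ*))`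
(`DGD_eq`), with `M∇_μ* = (∇_μM)*` and `∇_μM = (∇_μG^{(w′)})R₀`.  §2 **`l2blk_DGD_scaling`**: the `ℓ²`-BLOCK bound of `∇_λG∇_μ*`, uniform —
`∃ δ₂ > 0, C ≥ 0` (on `d, L, a₀, a₁`) with `|⟨v, ∇_λG∇_μ*u⟩| ≤ C·e^{−δ₂|y − y′|_T}‖v‖‖u‖` for fine bond fields `v` over `B^j(y)`, `u` over `B^j(y′)`,
every volume, `j + 1 ≤ m + K`, `Λ′`, weights `a₀n^{d+1} ≤ w ≤ a₁n^{d+1}`, directions `λ, μ` — file 24's `∇G^{(w′)}∇*` ([4]'s (1.114) member BY NAME),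
file 28a's pieces, file 25b's `R₀`, `M`, composed by file 23.  §3 THE PRINTED SHAPE **`prop25_ineq114_gradGdiv`**:
`Σ_{b₀}(ζ(b₀₋)(∇_λG∇_μ*J)(b₀))² ≤ (C·e^{(1+2δ₂)r}·e^{−δ₂|y−y′|_T}·Z)²·‖J‖²`, i.e. `‖ζ∇_λG∇_μ*J‖ ≤ C e^{(1+2δ₂)r}e^{−δ₂|y−y′|}|ζ|‖J‖`, for `J`
supported on the fine bonds over the unit sites within `r` of `y′`, `ζ` supported over those within `r` of `y`, `|ζ| ≤ Z`; and §4 the GLOBAL member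
**`prop25_ineq189_gradGdiv`**: `‖∇_λG∇_μ*J‖ ≤ C‖J‖` for every `J` ([4] (1.89) p.33; file 23b's block Schur test).
HONEST SCOPE / DIVERGENCES. (1) Per pair `(λ, μ)`; r03's census functional sums the pairs. (2) With files 15, 16, 22, 27 ALL SIX members of (1.114) and
all four of (1.110) are in the tree for the two-scale `G`; the Hölder members (1.111)–(1.113) remain with p38's lane. (3) `c = L^j`, weights in [4]'s
window, `w′ = n^{d+1}`; constants ours and crude. (4) No new definition, no new hypothesis.  NOT summit progress.  Unit `lit-balaban-p22` (gen 16), 2026-08-22.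
-/

noncomputable section

open scoped InnerProductSpace BigOperators Matrix
open Finset

namespace Literature.MathematicalPhysics.QuantumFieldTheory.Balaban1983to89.B6Prop25GradGDivDecayTwoScaleV1

open LatticeFieldCalculus B5SectBStatements B5Eq117TorusCarriers B6SectADomainsV1 B6SectAOperatorsV1 B6SectAVectorModelV1 B6SectCOperators
  B6SectCTwoScaleV1 B6SectCTwoScaleV1Lattice B5Eq118OneStroke
open BalabanImbrieJaffe1984to88.BIJ85AxialPropagator411 (BondSpace)
open B4Sect5Torus (IsPseudoDist SumBound)
open B4TorusKernel.MultiPeriod (torusSupNorm torusSupNorm_nonneg)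
open B4Sect5Proof (latticeConst latticeConst_nonneg)
open B5Local114GLattice (const114 delta114 const114_pos delta114_pos)
open B6LowerBound2153Torus (rep)
open B6Repr2129Operator (G_eq_op_V1)
open B6BlockDecayCalculus (torusDist_isPseudoDist torusDist_sumBound)
open B6BlockDecayGtV1 (Gt_eq_comp_GE)
open B6BlockDecayGDivBridgeV1 (adjoint_Dop)
open B6L2BlockCalculus (l2blk_comp l2blk_adjoint l2blk_add l2blk_sub l2blk_mono normSq_cut_apply_le_of_l2blk)
open B6L2BlockGlobalNorm (norm_apply_le_of_l2blk)
open B6L2Block114GEV1 (l2blk_DGEDadj_scaling)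
open B6L2BlockSmoothTermsV1 (M_eq_GE_comp_R0 adjoint_M_V1 l2blk_R0_scaling l2blk_M_scaling)
open B6L2BlockGradDivTermsV1 (l2blk_DK1Dadj_scaling l2blk_DHjQv_scaling l2blk_DHjCtHjD_scaling l2blk_DGE_scaling l2blk_GEDadj_scaling
  l2blk_DK2adj_scaling l2blk_K2Dadj_scaling)

variable {d L m K : ℕ} {hd : 1 ≤ d + 1} {hL : Odd L ∧ 1 < L} {j : ℕ}

/-! ## §1  The operator identity: one fine derivative on each side of (2.129) -/

section Identity

variable (hc : ((L : ℝ) ^ j) ≠ 0) (hj : j + 1 ≤ (⟨d + 1, L, m, K, hd, hL⟩ : Params).m + (⟨d + 1, L, m, K, hd, hL⟩ : Params).K) (Λ' : Finset (Site (⟨d + 1, L, m, K, hd, hL⟩ : Params) (j + 1))) {w : CIdx j Λ' → ℝ} (hw : ∀ i, 0 < w i)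
  (hw' : (0 : ℝ) < 1 * ((L : ℝ) ^ j) ^ (d + 1))

include hw in
/-- `∇_λM∇_μ* = ∇_λG^{(w′)}∇_μ* − (∇_λH_jQ_j)(G^{(w′)}∇_μ*) + ∇_λH_jC̃H_j*∇_μ*` (`G̃_j = (I − H_jQ_j)G^{(w′)}`, file 6). [cite: Balaban1984PropagatorsII, (2.129)–(2.131) p.246] -/
theorem DMDadj_eq (lam mu : Fin (d + 1)) : (((((L : ℝ) ^ j) • (onE (LinearMap.funLeft ℝ ℝ (fun b : PBond (⟨d + 1, L, m, K, hd, hL⟩ : Params) 0 => (⟨b.src.shift lam, b.dir⟩ : PBond (⟨d + 1, L, m, K, hd, hL⟩ : Params) 0))) - LinearMap.id) : BondSpace (⟨d + 1, L, m, K, hd, hL⟩ : Params) →ₗ[ℝ] BondSpace (⟨d + 1, L, m, K, hd, hL⟩ : Params))) ∘ₗ ((tsV1 hc Λ' w).Gt + (tsV1 hc Λ' w).Hj ∘ₗ (tsV1 hc Λ' w).Ct ∘ₗ LinearMap.adjoint (tsV1 hc Λ' w).Hj) ∘ₗ ((((L : ℝ) ^ j) • (onE (LinearMap.funLeft ℝ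 ℝ (fun b : PBond (⟨d + 1, L, m, K, hd, hL⟩ : Params) 0 => (⟨b.src.unshift mu, b.dir⟩ : PBond (⟨d + 1, L, m, K, hd, hL⟩ : Params) 0))) - LinearMap.id) : BondSpace (⟨d + 1, L, m, K, hd, hL⟩ : Params) →ₗ[ℝ] BondSpace (⟨d + 1, L, m, K, hd, hL⟩ : Params)))) = ((((((L : ℝ) ^ j) • (onE (LinearMap.funLeft ℝ ℝ (fun b : PBond (⟨d + 1, L, m, K, hd, hL⟩ : Params) 0 => (⟨b.src.shift lam, b.dir⟩ : PBond (⟨d + 1, L, m, K, hd, hL⟩ : Params) 0))) - LinearMap.id) : BondSpace (⟨d + 1, L, m, K, hd, hL⟩ : Params) →ₗ[ℝ] BondSpace (⟨d + 1, L, m, K, hd, hL⟩ : Params))) ∘ₗ (GE (Domains.whole (P := (⟨d + 1, L, m, K, hd, hL⟩ : Params)) j (Nat.le_of_succ_le hj)) hc (w := fun _ => 1 * ((L : ℝ) ^ j) ^ (d + 1)) (fun _ => hw')) ∘ₗ ((((L : ℝ) ^ j) • (onE (LinearMap.funLeft ℝ ℝ (fun b : PBond (⟨d + 1, L, m, K,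 hd, hL⟩ : Params) 0 => (⟨b.src.unshift mu, b.dir⟩ : PBond (⟨d + 1, L, m, K, hd, hL⟩ : Params) 0))) - LinearMap.id) : BondSpace (⟨d + 1, L, m, K, hd, hL⟩ : Params) →ₗ[ℝ] BondSpace (⟨d + 1, L, m, K, hd, hL⟩ : Params)))) - ((((((L : ℝ) ^ j) • (onE (LinearMap.funLeft ℝ ℝ (fun b : PBond (⟨d + 1, L, m, K, hd, hL⟩ : Params) 0 => (⟨b.src.shift lam, b.dir⟩ : PBond (⟨d + 1, L, m, K, hd, hL⟩ : Params) 0))) - LinearMap.id) : BondSpace (⟨d + 1, L, m, K, hd, hL⟩ : Params) →ₗ[ℝ] BondSpace (⟨d + 1, L, m, K, hd, hL⟩ : Params))) ∘ₗ (tsV1 hc Λ' w).Hj ∘ₗ (tsV1 hc Λ' w).Qv) ∘ₗ ((GE (Domains.whole (P := (⟨d + 1, L, m, K, hd, hL⟩ : Params)) j (Nat.le_of_succ_le hj)) hc (w := fun _ => 1 * ((L : ℝ) ^ j) ^ (d + 1)) (fun _ => hw')) ∘ₗ ((((L : ℝ) ^ j) • (onE (LinearMap.funLeft ℝ ℝ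 (fun b : PBond (⟨d + 1, L, m, K, hd, hL⟩ : Params) 0 => (⟨b.src.unshift mu, b.dir⟩ : PBond (⟨d + 1, L, m, K, hd, hL⟩ : Params) 0))) - LinearMap.id) : BondSpace (⟨d + 1, L, m, K, hd, hL⟩ : Params) →ₗ[ℝ] BondSpace (⟨d + 1, L, m, K, hd, hL⟩ : Params))))) + (((((L : ℝ) ^ j) • (onE (LinearMap.funLeft ℝ ℝ (fun b : PBond (⟨d + 1, L, m, K, hd, hL⟩ : Params) 0 => (⟨b.src.shift lam, b.dir⟩ : PBond (⟨d + 1, L, m, K, hd, hL⟩ : Params) 0))) - LinearMap.id) : BondSpace (⟨d + 1, L, m, K, hd, hL⟩ : Params) →ₗ[ℝ] BondSpace (⟨d + 1, L, m, K, hd, hL⟩ : Params))) ∘ₗ (tsV1 hc Λ' w).Hj ∘ₗ (tsV1 hc Λ' w).Ct ∘ₗ LinearMap.adjoint (tsV1 hc Λ' w).Hj ∘ₗ ((((L : ℝ) ^ j) • (onE (LinearMap.funLeft ℝ ℝ (fun b : PBond (⟨d + 1, L, m, K, hd, hL⟩ : Params) 0 => (⟨b.src.unshift mu, b.dir⟩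 : PBond (⟨d + 1, L, m, K, hd, hL⟩ : Params) 0))) - LinearMap.id) : BondSpace (⟨d + 1, L, m, K, hd, hL⟩ : Params) →ₗ[ℝ] BondSpace (⟨d + 1, L, m, K, hd, hL⟩ : Params))))) := by
  rw [Gt_eq_comp_GE hc hj Λ' hw hw']
  simp only [LinearMap.comp_add, LinearMap.comp_sub, LinearMap.sub_comp, LinearMap.add_comp, LinearMap.id_comp, LinearMap.comp_assoc]

include hw in
/-- `∇_λM = (∇_λG^{(w′)})R₀` (file 25b's `M_eq_GE_comp_R0`). [cite: Balaban1984PropagatorsII, (2.129)–(2.131) p.246] -/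
theorem DM_eq (lam : Fin (d + 1)) : (((((L : ℝ) ^ j) • (onE (LinearMap.funLeft ℝ ℝ (fun b : PBond (⟨d + 1, L, m, K, hd, hL⟩ : Params) 0 => (⟨b.src.shift lam, b.dir⟩ : PBond (⟨d + 1, L, m, K, hd, hL⟩ : Params) 0))) - LinearMap.id) : BondSpace (⟨d + 1, L, m, K, hd, hL⟩ : Params) →ₗ[ℝ] BondSpace (⟨d + 1, L, m, K, hd, hL⟩ : Params))) ∘ₗ ((tsV1 hc Λ' w).Gt + (tsV1 hc Λ' w).Hj ∘ₗ (tsV1 hc Λ' w).Ct ∘ₗ LinearMap.adjoint (tsV1 hc Λ' w).Hj)) = ((((((L : ℝ) ^ j) • (onE (LinearMap.funLeft ℝ ℝ (fun b : PBond (⟨d + 1, L, m, K, hd, hL⟩ : Params) 0 => (⟨b.src.shift lam, b.dir⟩ : PBond (⟨d + 1, L, m, K, hd, hL⟩ : Params) 0))) - LinearMap.id) : BondSpace (⟨d + 1, L, m, K, hd, hL⟩ : Params) →ₗ[ℝ] BondSpace (⟨d + 1, L, m, K, hd, hL⟩ : Params))) ∘ₗ (GE (Domains.whole (P := (⟨d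 + 1, L, m, K, hd, hL⟩ : Params)) j (Nat.le_of_succ_le hj)) hc (w := fun _ => 1 * ((L : ℝ) ^ j) ^ (d + 1)) (fun _ => hw'))) ∘ₗ ((LinearMap.id - LinearMap.adjoint (tsV1 hc Λ' w).Qv ∘ₗ ((tsV1 hc Λ' w).Δj + (1 * ((L : ℝ) ^ j) ^ (d + 1)) • (LinearMap.id : UBond (⟨d + 1, L, m, K, hd, hL⟩ : Params) j →ₗ[ℝ] UBond (⟨d + 1, L, m, K, hd, hL⟩ : Params) j)) ∘ₗ (tsV1 hc Λ' w).Qv ∘ₗ (GE (Domains.whole (P := (⟨d + 1, L, m, K, hd, hL⟩ : Params)) j (Nat.le_of_succ_le hj)) hc (w := fun _ => 1 * ((L : ℝ) ^ j) ^ (d + 1)) (fun _ => hw')) + LinearMap.adjoint (tsV1 hc Λ' w).Qv ∘ₗ ((tsV1 hc Λ' w).Δj + (1 * ((L : ℝ) ^ j) ^ (d + 1)) • (LinearMap.id : UBond (⟨d + 1, L, m, K, hd, hL⟩ : Params) j →ₗ[ℝ] UBond (⟨d + 1, L, m, K, hd, hL⟩ : Params) j)) ∘ₗ (tsV1 hc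 Λ' w).Ct ∘ₗ LinearMap.adjoint (tsV1 hc Λ' w).Hj : BondSpace (⟨d + 1, L, m, K, hd, hL⟩ : Params) →ₗ[ℝ] BondSpace (⟨d + 1, L, m, K, hd, hL⟩ : Params)))) := by
  rw [M_eq_GE_comp_R0 hc hj Λ' hw hw', LinearMap.comp_assoc]

include hj hw in
/-- `M∇_μ* = (∇_μM)*` (`M* = M`, file 25b). [cite: Balaban1984PropagatorsII, (2.129) p.246] -/
theorem MDadj_eq (mu : Fin (d + 1)) : (((tsV1 hc Λ' w).Gt + (tsV1 hc Λ' w).Hj ∘ₗ (tsV1 hc Λ' w).Ct ∘ₗ LinearMap.adjoint (tsV1 hc Λ' w).Hj) ∘ₗ ((((L : ℝ) ^ j) • (onE (LinearMap.funLeft ℝ ℝ (fun b : PBond (⟨d + 1, L, m, K, hd, hL⟩ : Params) 0 => (⟨b.src.unshift mu, b.dir⟩ : PBond (⟨d + 1, L, m, K, hd, hL⟩ : Params) 0))) - LinearMap.id) : BondSpace (⟨d + 1, L, m, K, hd, hL⟩ : Params) →ₗ[ℝ] BondSpace (⟨d + 1, L, m, K, hd, hL⟩ : Params)))) = LinearMap.adjoint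 (((((L : ℝ) ^ j) • (onE (LinearMap.funLeft ℝ ℝ (fun b : PBond (⟨d + 1, L, m, K, hd, hL⟩ : Params) 0 => (⟨b.src.shift mu, b.dir⟩ : PBond (⟨d + 1, L, m, K, hd, hL⟩ : Params) 0))) - LinearMap.id) : BondSpace (⟨d + 1, L, m, K, hd, hL⟩ : Params) →ₗ[ℝ] BondSpace (⟨d + 1, L, m, K, hd, hL⟩ : Params))) ∘ₗ ((tsV1 hc Λ' w).Gt + (tsV1 hc Λ' w).Hj ∘ₗ (tsV1 hc Λ' w).Ct ∘ₗ LinearMap.adjoint (tsV1 hc Λ' w).Hj)) := by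
  rw [LinearMap.adjoint_comp, adjoint_M_V1 hc hj Λ' hw, adjoint_Dop]

include hj hw in
/-- one derivative on each side of (2.129) with `M` kept whole: `∇_λG∇_μ* = ∇_λK₁∇_μ* + ∇_λM∇_μ* − (∇_λM)(K₂∇_μ*) − (∇_λK₂*)(M∇_μ*) + (∇_λK₂*)(M(K₂∇_μ*))`.
[cite: Balaban1984PropagatorsII, (2.129) p.246] -/
theorem DGD_eq_M (lam mu : Fin (d + 1)) : (((((L : ℝ) ^ j) • (onE (LinearMap.funLeft ℝ ℝ (fun b : PBond (⟨d + 1, L, m, K, hd, hL⟩ : Params) 0 => (⟨b.src.shift lam, b.dir⟩ : PBond (⟨d + 1, L, m, K, hd, hL⟩ : Params) 0))) - LinearMap.id) : BondSpace (⟨d + 1, L, m, K, hd, hL⟩ : Params) →ₗ[ℝ] BondSpace (⟨d + 1, L, m, K, hd, hL⟩ : Params))) ∘ₗ (tsV1 hc Λ' w).G ∘ₗ ((((L : ℝ) ^ j) • (onE (LinearMap.funLeft ℝ ℝ (fun b : PBond (⟨d + 1, L, m, K, hd, hL⟩ : Params) 0 => (⟨b.src.unshift mu, b.dir⟩ : PBond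 (⟨d + 1, L, m, K, hd, hL⟩ : Params) 0))) - LinearMap.id) : BondSpace (⟨d + 1, L, m, K, hd, hL⟩ : Params) →ₗ[ℝ] BondSpace (⟨d + 1, L, m, K, hd, hL⟩ : Params)))) = ((((((L : ℝ) ^ j) • (onE (LinearMap.funLeft ℝ ℝ (fun b : PBond (⟨d + 1, L, m, K, hd, hL⟩ : Params) 0 => (⟨b.src.shift lam, b.dir⟩ : PBond (⟨d + 1, L, m, K, hd, hL⟩ : Params) 0))) - LinearMap.id) : BondSpace (⟨d + 1, L, m, K, hd, hL⟩ : Params) →ₗ[ℝ] BondSpace (⟨d + 1, L, m, K, hd, hL⟩ : Params))) ∘ₗ (tsV1 hc Λ' w).K1 ∘ₗ ((((L : ℝ) ^ j) • (onE (LinearMap.funLeft ℝ ℝ (fun b : PBond (⟨d + 1, L, m, K, hd, hL⟩ : Params) 0 => (⟨b.src.unshift mu, b.dir⟩ : PBond (⟨d + 1, L, m, K, hd, hL⟩ : Params) 0))) - LinearMap.id) : BondSpace (⟨d + 1, L, m, K, hd, hL⟩ : Params) →ₗ[ℝ] BondSpace (⟨d + 1, L, m, K, hd, hL⟩ : Params))))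 + (((((L : ℝ) ^ j) • (onE (LinearMap.funLeft ℝ ℝ (fun b : PBond (⟨d + 1, L, m, K, hd, hL⟩ : Params) 0 => (⟨b.src.shift lam, b.dir⟩ : PBond (⟨d + 1, L, m, K, hd, hL⟩ : Params) 0))) - LinearMap.id) : BondSpace (⟨d + 1, L, m, K, hd, hL⟩ : Params) →ₗ[ℝ] BondSpace (⟨d + 1, L, m, K, hd, hL⟩ : Params))) ∘ₗ ((tsV1 hc Λ' w).Gt + (tsV1 hc Λ' w).Hj ∘ₗ (tsV1 hc Λ' w).Ct ∘ₗ LinearMap.adjoint (tsV1 hc Λ' w).Hj) ∘ₗ ((((L : ℝ) ^ j) • (onE (LinearMap.funLeft ℝ ℝ (fun b : PBond (⟨d + 1, L, m, K, hd, hL⟩ : Params) 0 => (⟨b.src.unshift mu, b.dir⟩ : PBond (⟨d + 1, L, m, K, hd, hL⟩ : Params) 0))) - LinearMap.id) : BondSpace (⟨d + 1, L, m, K, hd, hL⟩ : Params) →ₗ[ℝ] BondSpace (⟨d + 1, L, m, K, hd, hL⟩ : Params)))) - (((((L : ℝ) ^ j) • (onE (LinearMap.funLeft ℝ ℝ (fun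 b : PBond (⟨d + 1, L, m, K, hd, hL⟩ : Params) 0 => (⟨b.src.shift lam, b.dir⟩ : PBond (⟨d + 1, L, m, K, hd, hL⟩ : Params) 0))) - LinearMap.id) : BondSpace (⟨d + 1, L, m, K, hd, hL⟩ : Params) →ₗ[ℝ] BondSpace (⟨d + 1, L, m, K, hd, hL⟩ : Params))) ∘ₗ ((tsV1 hc Λ' w).Gt + (tsV1 hc Λ' w).Hj ∘ₗ (tsV1 hc Λ' w).Ct ∘ₗ LinearMap.adjoint (tsV1 hc Λ' w).Hj)) ∘ₗ ((tsV1 hc Λ' w).K2 ∘ₗ ((((L : ℝ) ^ j) • (onE (LinearMap.funLeft ℝ ℝ (fun b : PBond (⟨d + 1, L, m, K, hd, hL⟩ : Params) 0 => (⟨b.src.unshift mu, b.dir⟩ : PBond (⟨d + 1, L, m, K, hd, hL⟩ : Params) 0))) - LinearMap.id) : BondSpace (⟨d + 1, L, m, K, hd, hL⟩ : Params) →ₗ[ℝ] BondSpace (⟨d + 1, L, m, K, hd, hL⟩ : Params)))) - ((((((L : ℝ) ^ j) • (onE (LinearMap.funLeft ℝ ℝ (fun b : PBond (⟨d + 1,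 L, m, K, hd, hL⟩ : Params) 0 => (⟨b.src.shift lam, b.dir⟩ : PBond (⟨d + 1, L, m, K, hd, hL⟩ : Params) 0))) - LinearMap.id) : BondSpace (⟨d + 1, L, m, K, hd, hL⟩ : Params) →ₗ[ℝ] BondSpace (⟨d + 1, L, m, K, hd, hL⟩ : Params))) ∘ₗ LinearMap.adjoint (tsV1 hc Λ' w).K2) ∘ₗ (((tsV1 hc Λ' w).Gt + (tsV1 hc Λ' w).Hj ∘ₗ (tsV1 hc Λ' w).Ct ∘ₗ LinearMap.adjoint (tsV1 hc Λ' w).Hj) ∘ₗ ((((L : ℝ) ^ j) • (onE (LinearMap.funLeft ℝ ℝ (fun b : PBond (⟨d + 1, L, m, K, hd, hL⟩ : Params) 0 => (⟨b.src.unshift mu, b.dir⟩ : PBond (⟨d + 1, L, m, K, hd, hL⟩ : Params) 0))) - LinearMap.id) : BondSpace (⟨d + 1, L, m, K, hd, hL⟩ : Params) →ₗ[ℝ] BondSpace (⟨d + 1, L, m, K, hd, hL⟩ : Params))))) + ((((((L : ℝ) ^ j) • (onE (LinearMap.funLeft ℝ ℝ (fun b : PBond (⟨d + 1, L, m, K,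 hd, hL⟩ : Params) 0 => (⟨b.src.shift lam, b.dir⟩ : PBond (⟨d + 1, L, m, K, hd, hL⟩ : Params) 0))) - LinearMap.id) : BondSpace (⟨d + 1, L, m, K, hd, hL⟩ : Params) →ₗ[ℝ] BondSpace (⟨d + 1, L, m, K, hd, hL⟩ : Params))) ∘ₗ LinearMap.adjoint (tsV1 hc Λ' w).K2) ∘ₗ (((tsV1 hc Λ' w).Gt + (tsV1 hc Λ' w).Hj ∘ₗ (tsV1 hc Λ' w).Ct ∘ₗ LinearMap.adjoint (tsV1 hc Λ' w).Hj) ∘ₗ ((tsV1 hc Λ' w).K2 ∘ₗ ((((L : ℝ) ^ j) • (onE (LinearMap.funLeft ℝ ℝ (fun b : PBond (⟨d + 1, L, m, K, hd, hL⟩ : Params) 0 => (⟨b.src.unshift mu, b.dir⟩ : PBond (⟨d + 1, L, m, K, hd, hL⟩ : Params) 0))) - LinearMap.id) : BondSpace (⟨d + 1, L, m, K, hd, hL⟩ : Params) →ₗ[ℝ] BondSpace (⟨d + 1, L, m, K, hd, hL⟩ : Params))))))) := by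
  have hG := G_eq_op_V1 hc hj Λ' hw
  have hadj : LinearMap.adjoint (LinearMap.id - (tsV1 hc Λ' w).K2) = LinearMap.id - LinearMap.adjoint (tsV1 hc Λ' w).K2 := by
    rw [map_sub, LinearMap.adjoint_id]
  set Mop := ((tsV1 hc Λ' w).Gt + (tsV1 hc Λ' w).Hj ∘ₗ (tsV1 hc Λ' w).Ct ∘ₗ LinearMap.adjoint (tsV1 hc Λ' w).Hj) with hMop
  rw [hG, hadj]
  simp only [LinearMap.comp_add, LinearMap.comp_sub, LinearMap.sub_comp, LinearMap.add_comp, LinearMap.id_comp, LinearMap.comp_id,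
    LinearMap.comp_assoc]
  abel

include hw in
/-- **THE IDENTITY FOR `∇_λG∇_μ*`**: `∇_λG∇_μ* = ∇_λK₁∇_μ* + (∇_λG^{(w′)}∇_μ* − (∇_λH_jQ_j)(G^{(w′)}∇_μ*) + ∇_λH_jC̃H_j*∇_μ*) − ((∇_λG^{(w′)})R₀)(K₂∇_μ*)
− (∇_λK₂*)(M∇_μ*) + (∇_λK₂*)(M(K₂∇_μ*))`. [cite: Balaban1984PropagatorsII, (2.129)–(2.131) p.246] -/
theorem DGD_eq (lam mu : Fin (d + 1)) : (((((L : ℝ) ^ j) • (onE (LinearMap.funLeft ℝ ℝ (fun b : PBond (⟨d + 1, L, m, K, hd, hL⟩ : Params) 0 => (⟨b.src.shift lam, b.dir⟩ : PBond (⟨d + 1, L, m, K, hd, hL⟩ : Params) 0))) - LinearMap.id) : BondSpace (⟨d + 1, L, m, K, hd, hL⟩ : Params) →ₗ[ℝ] BondSpace (⟨d + 1, L, m, K, hd, hL⟩ : Params))) ∘ₗ (tsV1 hc Λ' w).G ∘ₗ ((((L : ℝ) ^ j) • (onE (LinearMap.funLeft ℝ ℝ (fun b : PBond (⟨d + 1,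 L, m, K, hd, hL⟩ : Params) 0 => (⟨b.src.unshift mu, b.dir⟩ : PBond (⟨d + 1, L, m, K, hd, hL⟩ : Params) 0))) - LinearMap.id) : BondSpace (⟨d + 1, L, m, K, hd, hL⟩ : Params) →ₗ[ℝ] BondSpace (⟨d + 1, L, m, K, hd, hL⟩ : Params)))) = ((((((L : ℝ) ^ j) • (onE (LinearMap.funLeft ℝ ℝ (fun b : PBond (⟨d + 1, L, m, K, hd, hL⟩ : Params) 0 => (⟨b.src.shift lam, b.dir⟩ : PBond (⟨d + 1, L, m, K, hd, hL⟩ : Params) 0))) - LinearMap.id) : BondSpace (⟨d + 1, L, m, K, hd, hL⟩ : Params) →ₗ[ℝ] BondSpace (⟨d + 1, L, m, K, hd, hL⟩ : Params))) ∘ₗ (tsV1 hc Λ' w).K1 ∘ₗ ((((L : ℝ) ^ j) • (onE (LinearMap.funLeft ℝ ℝ (fun b : PBond (⟨d + 1, L, m, K, hd, hL⟩ : Params) 0 => (⟨b.src.unshift mu, b.dir⟩ : PBond (⟨d + 1, L, m, K, hd, hL⟩ : Params) 0))) - LinearMap.id) : BondSpace (⟨d + 1, L, m, K, hd, hL⟩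 : Params) →ₗ[ℝ] BondSpace (⟨d + 1, L, m, K, hd, hL⟩ : Params)))) + ((((((L : ℝ) ^ j) • (onE (LinearMap.funLeft ℝ ℝ (fun b : PBond (⟨d + 1, L, m, K, hd, hL⟩ : Params) 0 => (⟨b.src.shift lam, b.dir⟩ : PBond (⟨d + 1, L, m, K, hd, hL⟩ : Params) 0))) - LinearMap.id) : BondSpace (⟨d + 1, L, m, K, hd, hL⟩ : Params) →ₗ[ℝ] BondSpace (⟨d + 1, L, m, K, hd, hL⟩ : Params))) ∘ₗ (GE (Domains.whole (P := (⟨d + 1, L, m, K, hd, hL⟩ : Params)) j (Nat.le_of_succ_le hj)) hc (w := fun _ => 1 * ((L : ℝ) ^ j) ^ (d + 1)) (fun _ => hw')) ∘ₗ ((((L : ℝ) ^ j) • (onE (LinearMap.funLeft ℝ ℝ (fun b : PBond (⟨d + 1, L, m, K, hd, hL⟩ : Params) 0 => (⟨b.src.unshift mu, b.dir⟩ : PBond (⟨d + 1, L, m, K, hd, hL⟩ : Params) 0))) - LinearMap.id) : BondSpace (⟨d + 1, L, m, K, hd, hL⟩ : Params) →ₗ[ℝ] BondSpace (⟨d + 1,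 L, m, K, hd, hL⟩ : Params)))) - ((((((L : ℝ) ^ j) • (onE (LinearMap.funLeft ℝ ℝ (fun b : PBond (⟨d + 1, L, m, K, hd, hL⟩ : Params) 0 => (⟨b.src.shift lam, b.dir⟩ : PBond (⟨d + 1, L, m, K, hd, hL⟩ : Params) 0))) - LinearMap.id) : BondSpace (⟨d + 1, L, m, K, hd, hL⟩ : Params) →ₗ[ℝ] BondSpace (⟨d + 1, L, m, K, hd, hL⟩ : Params))) ∘ₗ (tsV1 hc Λ' w).Hj ∘ₗ (tsV1 hc Λ' w).Qv) ∘ₗ ((GE (Domains.whole (P := (⟨d + 1, L, m, K, hd, hL⟩ : Params)) j (Nat.le_of_succ_le hj)) hc (w := fun _ => 1 * ((L : ℝ) ^ j) ^ (d + 1)) (fun _ => hw')) ∘ₗ ((((L : ℝ) ^ j) • (onE (LinearMap.funLeft ℝ ℝ (fun b : PBond (⟨d + 1, L, m, K, hd, hL⟩ : Params) 0 => (⟨b.src.unshift mu, b.dir⟩ : PBond (⟨d + 1, L, m, K, hd, hL⟩ : Params) 0))) - LinearMap.id) : BondSpace (⟨d + 1, L, m, K, hd, hL⟩ : Params) →ₗ[ℝ]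 BondSpace (⟨d + 1, L, m, K, hd, hL⟩ : Params))))) + (((((L : ℝ) ^ j) • (onE (LinearMap.funLeft ℝ ℝ (fun b : PBond (⟨d + 1, L, m, K, hd, hL⟩ : Params) 0 => (⟨b.src.shift lam, b.dir⟩ : PBond (⟨d + 1, L, m, K, hd, hL⟩ : Params) 0))) - LinearMap.id) : BondSpace (⟨d + 1, L, m, K, hd, hL⟩ : Params) →ₗ[ℝ] BondSpace (⟨d + 1, L, m, K, hd, hL⟩ : Params))) ∘ₗ (tsV1 hc Λ' w).Hj ∘ₗ (tsV1 hc Λ' w).Ct ∘ₗ LinearMap.adjoint (tsV1 hc Λ' w).Hj ∘ₗ ((((L : ℝ) ^ j) • (onE (LinearMap.funLeft ℝ ℝ (fun b : PBond (⟨d + 1, L, m, K, hd, hL⟩ : Params) 0 => (⟨b.src.unshift mu, b.dir⟩ : PBond (⟨d + 1, L, m, K, hd, hL⟩ : Params) 0))) - LinearMap.id) : BondSpace (⟨d + 1, L, m, K, hd, hL⟩ : Params) →ₗ[ℝ] BondSpace (⟨d + 1, L, m, K, hd, hL⟩ : Params))))) - (((((((L : ℝ) ^ j) • (onE (LinearMap.funLeft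 ℝ ℝ (fun b : PBond (⟨d + 1, L, m, K, hd, hL⟩ : Params) 0 => (⟨b.src.shift lam, b.dir⟩ : PBond (⟨d + 1, L, m, K, hd, hL⟩ : Params) 0))) - LinearMap.id) : BondSpace (⟨d + 1, L, m, K, hd, hL⟩ : Params) →ₗ[ℝ] BondSpace (⟨d + 1, L, m, K, hd, hL⟩ : Params))) ∘ₗ (GE (Domains.whole (P := (⟨d + 1, L, m, K, hd, hL⟩ : Params)) j (Nat.le_of_succ_le hj)) hc (w := fun _ => 1 * ((L : ℝ) ^ j) ^ (d + 1)) (fun _ => hw'))) ∘ₗ ((LinearMap.id - LinearMap.adjoint (tsV1 hc Λ' w).Qv ∘ₗ ((tsV1 hc Λ' w).Δj + (1 * ((L : ℝ) ^ j) ^ (d + 1)) • (LinearMap.id : UBond (⟨d + 1, L, m, K, hd, hL⟩ : Params) j →ₗ[ℝ] UBond (⟨d + 1, L, m, K, hd, hL⟩ : Params) j)) ∘ₗ (tsV1 hc Λ' w).Qv ∘ₗ (GE (Domains.whole (P := (⟨d + 1, L, m, K, hd, hL⟩ : Params)) j (Nat.le_of_succ_le hj)) hc (w := fun _ => 1 *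 ((L : ℝ) ^ j) ^ (d + 1)) (fun _ => hw')) + LinearMap.adjoint (tsV1 hc Λ' w).Qv ∘ₗ ((tsV1 hc Λ' w).Δj + (1 * ((L : ℝ) ^ j) ^ (d + 1)) • (LinearMap.id : UBond (⟨d + 1, L, m, K, hd, hL⟩ : Params) j →ₗ[ℝ] UBond (⟨d + 1, L, m, K, hd, hL⟩ : Params) j)) ∘ₗ (tsV1 hc Λ' w).Ct ∘ₗ LinearMap.adjoint (tsV1 hc Λ' w).Hj : BondSpace (⟨d + 1, L, m, K, hd, hL⟩ : Params) →ₗ[ℝ] BondSpace (⟨d + 1, L, m, K, hd, hL⟩ : Params)))) ∘ₗ ((tsV1 hc Λ' w).K2 ∘ₗ ((((L : ℝ) ^ j) • (onE (LinearMap.funLeft ℝ ℝ (fun b : PBond (⟨d + 1, L, m, K, hd, hL⟩ : Params) 0 => (⟨b.src.unshift mu, b.dir⟩ : PBond (⟨d + 1, L, m, K, hd, hL⟩ : Params) 0))) - LinearMap.id) : BondSpace (⟨d + 1, L, m, K, hd, hL⟩ : Params) →ₗ[ℝ] BondSpace (⟨d + 1, L, m, K, hd, hL⟩ : Params))))) -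 ((((((L : ℝ) ^ j) • (onE (LinearMap.funLeft ℝ ℝ (fun b : PBond (⟨d + 1, L, m, K, hd, hL⟩ : Params) 0 => (⟨b.src.shift lam, b.dir⟩ : PBond (⟨d + 1, L, m, K, hd, hL⟩ : Params) 0))) - LinearMap.id) : BondSpace (⟨d + 1, L, m, K, hd, hL⟩ : Params) →ₗ[ℝ] BondSpace (⟨d + 1, L, m, K, hd, hL⟩ : Params))) ∘ₗ LinearMap.adjoint (tsV1 hc Λ' w).K2) ∘ₗ (((tsV1 hc Λ' w).Gt + (tsV1 hc Λ' w).Hj ∘ₗ (tsV1 hc Λ' w).Ct ∘ₗ LinearMap.adjoint (tsV1 hc Λ' w).Hj) ∘ₗ ((((L : ℝ) ^ j) • (onE (LinearMap.funLeft ℝ ℝ (fun b : PBond (⟨d + 1, L, m, K, hd, hL⟩ : Params) 0 => (⟨b.src.unshift mu, b.dir⟩ : PBond (⟨d + 1, L, m, K, hd, hL⟩ : Params) 0))) - LinearMap.id) : BondSpace (⟨d + 1, L, m, K, hd, hL⟩ : Params) →ₗ[ℝ] BondSpace (⟨d + 1, L, m, K, hd, hL⟩ : Params))))) + ((((((L :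 ℝ) ^ j) • (onE (LinearMap.funLeft ℝ ℝ (fun b : PBond (⟨d + 1, L, m, K, hd, hL⟩ : Params) 0 => (⟨b.src.shift lam, b.dir⟩ : PBond (⟨d + 1, L, m, K, hd, hL⟩ : Params) 0))) - LinearMap.id) : BondSpace (⟨d + 1, L, m, K, hd, hL⟩ : Params) →ₗ[ℝ] BondSpace (⟨d + 1, L, m, K, hd, hL⟩ : Params))) ∘ₗ LinearMap.adjoint (tsV1 hc Λ' w).K2) ∘ₗ (((tsV1 hc Λ' w).Gt + (tsV1 hc Λ' w).Hj ∘ₗ (tsV1 hc Λ' w).Ct ∘ₗ LinearMap.adjoint (tsV1 hc Λ' w).Hj) ∘ₗ ((tsV1 hc Λ' w).K2 ∘ₗ ((((L : ℝ) ^ j) • (onE (LinearMap.funLeft ℝ ℝ (fun b : PBond (⟨d + 1, L, m, K, hd, hL⟩ : Params) 0 => (⟨b.src.unshift mu, b.dir⟩ : PBond (⟨d + 1, L, m, K, hd, hL⟩ : Params) 0))) - LinearMap.id) : BondSpace (⟨d + 1, L, m, K, hd, hL⟩ : Params) →ₗ[ℝ] BondSpace (⟨d + 1, L, m, K, hd,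 hL⟩ : Params))))))) := by
  rw [← DM_eq hc hj Λ' hw hw' lam, ← DMDadj_eq hc hj Λ' hw hw' lam mu]
  exact DGD_eq_M hc hj Λ' hw lam mu

end Identity

/-! ## §2  The `ℓ²`-block bound of `∇_λG∇_μ*`, uniformly at the scaling -/

set_option maxHeartbeats 1600000 in
set_option maxRecDepth 8192 in
open Classical in
/-- **PROPOSITION 2.5, THE `ℓ²`-BLOCK BOUND OF `∇_λG∇_μ*` FOR THE TWO-SCALE `G`** (`c = L^j`, weights `a₀n^{d+1} ≤ w ≤ a₁n^{d+1}`): there are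
`δ₂ > 0`, `C ≥ 0` depending on `d, L, a₀, a₁` only such that for every volume, `j + 1 ≤ m + K`, `Λ′`, weights in the window, directions `λ, μ`,
unit sites `y, y′` and fine bond fields `v` over `B^j(y)`, `u` over `B^j(y′)`: `|⟨v, ∇_λG∇_μ*u⟩| ≤ C·e^{−δ₂|y − y′|_T}‖v‖‖u‖` — §1's identity, [4]
(1.114) for `∇G^{(w′)}∇*` (file 24), the pieces of file 28a and the smooth factors of file 25b, composed by file 23.
[cite: Balaban1984PropagatorsII, Prop. 2.5 p.246; Balaban1984PropagatorsI, Prop. 1.2 (1.114) p.36] -/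
theorem l2blk_DGD_scaling (d L : ℕ) (hd : 1 ≤ d + 1) (hL : Odd L ∧ 1 < L) {a₀ a₁ : ℝ} (ha₀ : 0 < a₀) (ha₁ : a₀ ≤ a₁) :
    ∃ δ : ℝ, 0 < δ ∧ ∃ C : ℝ, 0 ≤ C ∧ ∀ (m K : ℕ) (j : ℕ) (hc : ((L : ℝ) ^ j) ≠ 0)
      (_hj : j + 1 ≤ (⟨d + 1, L, m, K, hd, hL⟩ : Params).m + (⟨d + 1, L, m, K, hd, hL⟩ : Params).K)
      (Λ' : Finset (Site (⟨d + 1, L, m, K, hd, hL⟩ : Params) (j + 1))) (w : CIdx j Λ' → ℝ)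
      (_hw0 : ∀ i, a₀ * ((L : ℝ) ^ j) ^ (d + 1) ≤ w i) (_hw1 : ∀ i, w i ≤ a₁ * ((L : ℝ) ^ j) ^ (d + 1)) (lam mu : Fin (d + 1))
      (y y' : Site (⟨d + 1, L, m, K, hd, hL⟩ : Params) j) (v u : BondSpace (⟨d + 1, L, m, K, hd, hL⟩ : Params))
      (_hv : ∀ b : PBond (⟨d + 1, L, m, K, hd, hL⟩ : Params) 0, iterBlockOf j b.src ≠ y → v b = 0) (_hu : ∀ b : PBond (⟨d + 1, L, m, K, hd, hL⟩ : Params) 0, iterBlockOf j b.src ≠ y' → u b = 0),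
      |⟪v, (((((L : ℝ) ^ j) • (onE (LinearMap.funLeft ℝ ℝ (fun b : PBond (⟨d + 1, L, m, K, hd, hL⟩ : Params) 0 => (⟨b.src.shift lam, b.dir⟩ : PBond (⟨d + 1, L, m, K, hd, hL⟩ : Params) 0))) - LinearMap.id) : BondSpace (⟨d + 1, L, m, K, hd, hL⟩ : Params) →ₗ[ℝ] BondSpace (⟨d + 1, L, m, K, hd, hL⟩ : Params))) ∘ₗ (tsV1 hc Λ' w).G ∘ₗ ((((L : ℝ) ^ j) • (onE (LinearMap.funLeft ℝ ℝ (fun b : PBond (⟨d + 1, L, m, K, hd, hL⟩ : Params) 0 => (⟨b.src.unshift mu, b.dir⟩ : PBond (⟨d + 1, L, m, K, hd, hL⟩ : Params) 0))) - LinearMap.id) : BondSpace (⟨d + 1, L, m, K, hd, hL⟩ : Params) →ₗ[ℝ] BondSpace (⟨d + 1, L, m, K, hd, hL⟩ : Params)))) u⟫_ℝ| ≤ C * Real.exp (-(δ * torusSupNorm (Mk (⟨d + 1, L, m, K, hd, hL⟩ : Params) j) (rep (Mk (⟨d + 1, L, m, K, hd, hL⟩ : Params) j) y - rep (Mk (⟨d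 + 1, L, m, K, hd, hL⟩ : Params) j) y'))) * (‖v‖ * ‖u‖) := by
  obtain ⟨δ₁, hδ₁, C₁, hC₁, hT1⟩ := l2blk_DK1Dadj_scaling d L hd hL
  obtain ⟨δ₃, hδ₃, C₃, hC₃, hT3⟩ := l2blk_DHjQv_scaling d L hd hL
  obtain ⟨δ₄, hδ₄, C₄, hC₄, hT4⟩ := l2blk_DHjCtHjD_scaling d L hd hL ha₀ ha₁
  obtain ⟨δ₅, hδ₅, C₅, hC₅, hDG⟩ := l2blk_DGE_scaling d L hd hL one_pos
  obtain ⟨δ₆, hδ₆, C₆, hC₆, hGD⟩ := l2blk_GEDadj_scaling d L hd hL one_pos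
  obtain ⟨δ₇, hδ₇, C₇, hC₇, hR0⟩ := l2blk_R0_scaling d L hd hL ha₀ ha₁
  obtain ⟨δ₈, hδ₈, C₈, hC₈, hM⟩ := l2blk_M_scaling d L hd hL ha₀ ha₁
  obtain ⟨δ₉, hδ₉, C₉, hC₉, hDK2⟩ := l2blk_DK2adj_scaling d L hd hL
  obtain ⟨δ₀', hδ₀', C₀, hC₀, hK2D⟩ := l2blk_K2Dadj_scaling d L hd hL
  have hδ₂ : 0 < delta114 (d + 1) 1 := delta114_pos _ one_pos
  have hC₂ : 0 ≤ const114 (d + 1) 1 := (const114_pos _ _).le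
  -- the common rate
  set δ₀ : ℝ := min (min (min δ₁ (delta114 (d + 1) 1)) (min δ₃ δ₄)) (min (min (min δ₅ δ₆) (min δ₇ δ₈)) (min δ₉ δ₀')) with hδ₀
  have hδ₀0 : 0 < δ₀ :=
    lt_min (lt_min (lt_min hδ₁ hδ₂) (lt_min hδ₃ hδ₄)) (lt_min (lt_min (lt_min hδ₅ hδ₆) (lt_min hδ₇ hδ₈)) (lt_min hδ₉ hδ₀'))
  have h01 : δ₀ ≤ δ₁ := (min_le_left _ _).trans ((min_le_left _ _).trans (min_le_left _ _))
  have h02 : δ₀ ≤ delta114 (d + 1) 1 := (min_le_left _ _).trans ((min_le_left _ _).trans (min_le_right _ _))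
  have h03 : δ₀ ≤ δ₃ := (min_le_left _ _).trans ((min_le_right _ _).trans (min_le_left _ _))
  have h04 : δ₀ ≤ δ₄ := (min_le_left _ _).trans ((min_le_right _ _).trans (min_le_right _ _))
  have h05 : δ₀ ≤ δ₅ := (min_le_right _ _).trans ((min_le_left _ _).trans ((min_le_left _ _).trans (min_le_left _ _)))
  have h06 : δ₀ ≤ δ₆ := (min_le_right _ _).trans ((min_le_left _ _).trans ((min_le_left _ _).trans (min_le_right _ _)))
  have h07 : δ₀ ≤ δ₇ := (min_le_right _ _).trans ((min_le_left _ _).trans ((min_le_right _ _).trans (min_le_left _ _)))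
  have h08 : δ₀ ≤ δ₈ := (min_le_right _ _).trans ((min_le_left _ _).trans ((min_le_right _ _).trans (min_le_right _ _)))
  have h09 : δ₀ ≤ δ₉ := (min_le_right _ _).trans ((min_le_right _ _).trans (min_le_left _ _))
  have h00 : δ₀ ≤ δ₀' := (min_le_right _ _).trans ((min_le_right _ _).trans (min_le_right _ _))
  set Ka : ℝ := latticeConst (d + 1) (δ₀ - δ₀ / 2) with hKa
  set Kb : ℝ := latticeConst (d + 1) (δ₀ / 2 - δ₀ / 4) with hKb
  set Kc : ℝ := latticeConst (d + 1) (δ₀ - δ₀ / 4) with hKc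
  have hKa0 : 0 ≤ Ka := latticeConst_nonneg _ (by linarith)
  have hKb0 : 0 ≤ Kb := latticeConst_nonneg _ (by linarith)
  have hKc0 : 0 ≤ Kc := latticeConst_nonneg _ (by linarith)
  set C : ℝ := C₁ + (const114 (d + 1) 1 + C₃ * C₆ * Ka + C₄) + C₅ * C₇ * Ka * C₀ * Kb + C₉ * (C₅ * C₇ * Ka) * Kc +
    C₉ * (C₈ * C₀ * Ka) * Kc with hC
  have hC0 : 0 ≤ C := by positivity
  refine ⟨δ₀ / 4, by positivity, C, hC0, ?_⟩
  intro m K j hc hj Λ' w hw0 hw1 lam mu y y' v u hv hu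
  have hL0 : 0 < L := by have := hL.2; omega
  haveI : NeZero L := ⟨by omega⟩
  have hLp : (0 : ℝ) < L := by exact_mod_cast hL0
  have hj' : j ≤ m + K := Nat.le_of_succ_le hj
  have hw : ∀ i, 0 < w i := fun i => lt_of_lt_of_le (by positivity) (hw0 i)
  have hw' : (0 : ℝ) < 1 * ((L : ℝ) ^ j) ^ (d + 1) := by positivity
  have hρ : IsPseudoDist (fun t t' : Site (⟨d + 1, L, m, K, hd, hL⟩ : Params) j => torusSupNorm (Mk (⟨d + 1, L, m, K, hd, hL⟩ : Params) j) (rep (Mk (⟨d + 1, L, m, K, hd, hL⟩ : Params) j) t - rep (Mk (⟨d + 1, L, m, K, hd, hL⟩ : Params) j) t')) := torusDist_isPseudoDist (Mk (⟨d + 1, L, m, K, hd, hL⟩ : Params) j)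
  have hK : SumBound (fun t t' : Site (⟨d + 1, L, m, K, hd, hL⟩ : Params) j => torusSupNorm (Mk (⟨d + 1, L, m, K, hd, hL⟩ : Params) j) (rep (Mk (⟨d + 1, L, m, K, hd, hL⟩ : Params) j) t - rep (Mk (⟨d + 1, L, m, K, hd, hL⟩ : Params) j) t')) (fun a => latticeConst (d + 1) a) := torusDist_sumBound (Mk (⟨d + 1, L, m, K, hd, hL⟩ : Params) j)
  -- (a) the ingredients at the common rate `δ₀`
  have b1 := l2blk_mono hρ (((((L : ℝ) ^ j) • (onE (LinearMap.funLeft ℝ ℝ (fun b : PBond (⟨d + 1, L, m, K, hd, hL⟩ : Params) 0 => (⟨b.src.shift lam, b.dir⟩ : PBond (⟨d + 1, L, m, K, hd, hL⟩ : Params) 0))) - LinearMap.id) : BondSpace (⟨d + 1, L, m, K, hd, hL⟩ : Params) →ₗ[ℝ] BondSpace (⟨d + 1, L, m, K, hd, hL⟩ : Params))) ∘ₗ (tsV1 hc Λ' w).K1 ∘ₗ ((((L : ℝ) ^ j) • (onE (LinearMap.funLeft ℝ ℝ (fun b : PBond (⟨d + 1, L, m, K, hd, hL⟩ : Params) 0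 => (⟨b.src.unshift mu, b.dir⟩ : PBond (⟨d + 1, L, m, K, hd, hL⟩ : Params) 0))) - LinearMap.id) : BondSpace (⟨d + 1, L, m, K, hd, hL⟩ : Params) →ₗ[ℝ] BondSpace (⟨d + 1, L, m, K, hd, hL⟩ : Params)))) (fun b₀ : PBond (⟨d + 1, L, m, K, hd, hL⟩ : Params) 0 => iterBlockOf j b₀.src) (fun b₀ : PBond (⟨d + 1, L, m, K, hd, hL⟩ : Params) 0 => iterBlockOf j b₀.src) hC₁ le_rfl h01 (hT1 m K j hc hj Λ' w hw lam mu)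
  have b2raw : ∀ (y₁ y₂ : Site (⟨d + 1, L, m, K, hd, hL⟩ : Params) j) (v' u' : BondSpace (⟨d + 1, L, m, K, hd, hL⟩ : Params)), (∀ b : PBond (⟨d + 1, L, m, K, hd, hL⟩ : Params) 0, iterBlockOf j b.src ≠ y₁ → v' b = 0) →
      (∀ b : PBond (⟨d + 1, L, m, K, hd, hL⟩ : Params) 0, iterBlockOf j b.src ≠ y₂ → u' b = 0) →
      |⟪v', (((((L : ℝ) ^ j) • (onE (LinearMap.funLeft ℝ ℝ (fun b : PBond (⟨d + 1, L, m, K, hd, hL⟩ : Params) 0 => (⟨b.src.shift lam, b.dir⟩ : PBond (⟨d + 1, L, m, K, hd, hL⟩ : Params) 0))) - LinearMap.id) : BondSpace (⟨d + 1, L, m, K, hd, hL⟩ : Params) →ₗ[ℝ] BondSpace (⟨d + 1, L, m, K, hd, hL⟩ : Params))) ∘ₗ (GE (Domains.whole (P := (⟨d + 1, L, m, K, hd, hL⟩ : Params)) j (Nat.le_of_succ_le hj)) hc (w := fun _ => 1 * ((L : ℝ) ^ j) ^ (d + 1)) (fun _ => hw')) ∘ₗ ((((L : ℝ) ^ j)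 • (onE (LinearMap.funLeft ℝ ℝ (fun b : PBond (⟨d + 1, L, m, K, hd, hL⟩ : Params) 0 => (⟨b.src.unshift mu, b.dir⟩ : PBond (⟨d + 1, L, m, K, hd, hL⟩ : Params) 0))) - LinearMap.id) : BondSpace (⟨d + 1, L, m, K, hd, hL⟩ : Params) →ₗ[ℝ] BondSpace (⟨d + 1, L, m, K, hd, hL⟩ : Params)))) u'⟫_ℝ| ≤ const114 (d + 1) 1 * Real.exp (-(delta114 (d + 1) 1 * torusSupNorm (Mk (⟨d + 1, L, m, K, hd, hL⟩ : Params) j) (rep (Mk (⟨d + 1, L, m, K, hd, hL⟩ : Params) j) y₁ - rep (Mk (⟨d + 1, L, m, K, hd, hL⟩ : Params) j) y₂))) * (‖v'‖ * ‖u'‖) :=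
    fun y₁ y₂ v' u' hv' hu' => l2blk_DGEDadj_scaling (Nat.le_of_succ_le hj) hc one_pos hw' lam mu y₁ y₂ v' u' hv' hu'
  have b2 := l2blk_mono hρ (((((L : ℝ) ^ j) • (onE (LinearMap.funLeft ℝ ℝ (fun b : PBond (⟨d + 1, L, m, K, hd, hL⟩ : Params) 0 => (⟨b.src.shift lam, b.dir⟩ : PBond (⟨d + 1, L, m, K, hd, hL⟩ : Params) 0))) - LinearMap.id) : BondSpace (⟨d + 1, L, m, K, hd, hL⟩ : Params) →ₗ[ℝ] BondSpace (⟨d + 1, L, m, K, hd, hL⟩ : Params))) ∘ₗ (GE (Domains.whole (P := (⟨d + 1, L, m, K, hd, hL⟩ : Params)) j (Nat.le_of_succ_le hj)) hc (w := fun _ => 1 * ((L : ℝ) ^ j) ^ (d + 1)) (fun _ => hw')) ∘ₗ ((((L : ℝ) ^ j) • (onE (LinearMap.funLeft ℝ ℝ (fun b : PBond (⟨d + 1, L, m, K, hd, hL⟩ : Params) 0 => (⟨b.src.unshift mu, b.dir⟩ : PBond (⟨d + 1, L, m, K, hd, hL⟩ : Params) 0))) - LinearMap.id) : BondSpace (⟨d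 + 1, L, m, K, hd, hL⟩ : Params) →ₗ[ℝ] BondSpace (⟨d + 1, L, m, K, hd, hL⟩ : Params)))) (fun b₀ : PBond (⟨d + 1, L, m, K, hd, hL⟩ : Params) 0 => iterBlockOf j b₀.src) (fun b₀ : PBond (⟨d + 1, L, m, K, hd, hL⟩ : Params) 0 => iterBlockOf j b₀.src) hC₂ le_rfl h02 b2raw
  have b3 := l2blk_mono hρ (((((L : ℝ) ^ j) • (onE (LinearMap.funLeft ℝ ℝ (fun b : PBond (⟨d + 1, L, m, K, hd, hL⟩ : Params) 0 => (⟨b.src.shift lam, b.dir⟩ : PBond (⟨d + 1, L, m, K, hd, hL⟩ : Params) 0))) - LinearMap.id) : BondSpace (⟨d + 1, L, m, K, hd, hL⟩ : Params) →ₗ[ℝ] BondSpace (⟨d + 1, L, m, K, hd, hL⟩ : Params))) ∘ₗ (tsV1 hc Λ' w).Hj ∘ₗ (tsV1 hc Λ' w).Qv) (fun b₀ : PBond (⟨d + 1, L, m, K, hd, hL⟩ : Params) 0 => iterBlockOf j b₀.src) (fun b₀ : PBond (⟨d + 1, L, m, K, hd, hL⟩ : Params) 0 => iterBlockOf j b₀.src)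 hC₃ le_rfl h03 (hT3 m K j hc hj Λ' w hw lam)
  have b4 := l2blk_mono hρ (((((L : ℝ) ^ j) • (onE (LinearMap.funLeft ℝ ℝ (fun b : PBond (⟨d + 1, L, m, K, hd, hL⟩ : Params) 0 => (⟨b.src.shift lam, b.dir⟩ : PBond (⟨d + 1, L, m, K, hd, hL⟩ : Params) 0))) - LinearMap.id) : BondSpace (⟨d + 1, L, m, K, hd, hL⟩ : Params) →ₗ[ℝ] BondSpace (⟨d + 1, L, m, K, hd, hL⟩ : Params))) ∘ₗ (tsV1 hc Λ' w).Hj ∘ₗ (tsV1 hc Λ' w).Ct ∘ₗ LinearMap.adjoint (tsV1 hc Λ' w).Hj ∘ₗ ((((L : ℝ) ^ j) • (onE (LinearMap.funLeft ℝ ℝ (fun b : PBond (⟨d + 1, L, m, K, hd, hL⟩ : Params) 0 => (⟨b.src.unshift mu, b.dir⟩ : PBond (⟨d + 1, L, m, K, hd, hL⟩ : Params) 0))) - LinearMap.id) : BondSpace (⟨d + 1, L, m, K, hd, hL⟩ : Params) →ₗ[ℝ] BondSpace (⟨d + 1, L, m, K, hd, hL⟩ : Params)))) (fun b₀ : PBond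 (⟨d + 1, L, m, K, hd, hL⟩ : Params) 0 => iterBlockOf j b₀.src) (fun b₀ : PBond (⟨d + 1, L, m, K, hd, hL⟩ : Params) 0 => iterBlockOf j b₀.src) hC₄ le_rfl h04 (hT4 m K j hc hj Λ' w hw0 hw1 lam mu)
  have b5l := l2blk_mono hρ (((((L : ℝ) ^ j) • (onE (LinearMap.funLeft ℝ ℝ (fun b : PBond (⟨d + 1, L, m, K, hd, hL⟩ : Params) 0 => (⟨b.src.shift lam, b.dir⟩ : PBond (⟨d + 1, L, m, K, hd, hL⟩ : Params) 0))) - LinearMap.id) : BondSpace (⟨d + 1, L, m, K, hd, hL⟩ : Params) →ₗ[ℝ] BondSpace (⟨d + 1, L, m, K, hd, hL⟩ : Params))) ∘ₗ (GE (Domains.whole (P := (⟨d + 1, L, m, K, hd, hL⟩ : Params)) j (Nat.le_of_succ_le hj)) hc (w := fun _ => 1 * ((L : ℝ) ^ j) ^ (d + 1)) (fun _ => hw'))) (fun b₀ : PBond (⟨d + 1, L, m, K, hd, hL⟩ : Params) 0 => iterBlockOf j b₀.src) (fun b₀ : PBond (⟨d + 1, L, m, K, hd, hL⟩ : Params) 0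 => iterBlockOf j b₀.src) hC₅ le_rfl h05 (hDG m K j (Nat.le_of_succ_le hj) hc hw' lam)
  have b5m := l2blk_mono hρ (((((L : ℝ) ^ j) • (onE (LinearMap.funLeft ℝ ℝ (fun b : PBond (⟨d + 1, L, m, K, hd, hL⟩ : Params) 0 => (⟨b.src.shift mu, b.dir⟩ : PBond (⟨d + 1, L, m, K, hd, hL⟩ : Params) 0))) - LinearMap.id) : BondSpace (⟨d + 1, L, m, K, hd, hL⟩ : Params) →ₗ[ℝ] BondSpace (⟨d + 1, L, m, K, hd, hL⟩ : Params))) ∘ₗ (GE (Domains.whole (P := (⟨d + 1, L, m, K, hd, hL⟩ : Params)) j (Nat.le_of_succ_le hj)) hc (w := fun _ => 1 * ((L : ℝ) ^ j) ^ (d + 1)) (fun _ => hw'))) (fun b₀ : PBond (⟨d + 1, L, m, K, hd, hL⟩ : Params) 0 => iterBlockOf j b₀.src) (fun b₀ : PBond (⟨d + 1, L, m, K, hd, hL⟩ : Params) 0 => iterBlockOf j b₀.src) hC₅ le_rfl h05 (hDG m K j (Nat.le_of_succ_le hj) hc hw' mu)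
  have b6 := l2blk_mono hρ ((GE (Domains.whole (P := (⟨d + 1, L, m, K, hd, hL⟩ : Params)) j (Nat.le_of_succ_le hj)) hc (w := fun _ => 1 * ((L : ℝ) ^ j) ^ (d + 1)) (fun _ => hw')) ∘ₗ ((((L : ℝ) ^ j) • (onE (LinearMap.funLeft ℝ ℝ (fun b : PBond (⟨d + 1, L, m, K, hd, hL⟩ : Params) 0 => (⟨b.src.unshift mu, b.dir⟩ : PBond (⟨d + 1, L, m, K, hd, hL⟩ : Params) 0))) - LinearMap.id) : BondSpace (⟨d + 1, L, m, K, hd, hL⟩ : Params) →ₗ[ℝ] BondSpace (⟨d + 1, L, m, K, hd, hL⟩ : Params)))) (fun b₀ : PBond (⟨d + 1, L, m, K, hd, hL⟩ : Params) 0 => iterBlockOf j b₀.src) (fun b₀ : PBond (⟨d + 1, L, m, K, hd, hL⟩ : Params) 0 => iterBlockOf j b₀.src) hC₆ le_rfl h06 (hGD m K j (Nat.le_of_succ_le hj) hc hw' mu)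
  have b7 := l2blk_mono hρ ((LinearMap.id - LinearMap.adjoint (tsV1 hc Λ' w).Qv ∘ₗ ((tsV1 hc Λ' w).Δj + (1 * ((L : ℝ) ^ j) ^ (d + 1)) • (LinearMap.id : UBond (⟨d + 1, L, m, K, hd, hL⟩ : Params) j →ₗ[ℝ] UBond (⟨d + 1, L, m, K, hd, hL⟩ : Params) j)) ∘ₗ (tsV1 hc Λ' w).Qv ∘ₗ (GE (Domains.whole (P := (⟨d + 1, L, m, K, hd, hL⟩ : Params)) j (Nat.le_of_succ_le hj)) hc (w := fun _ => 1 * ((L : ℝ) ^ j) ^ (d + 1)) (fun _ => hw')) + LinearMap.adjoint (tsV1 hc Λ' w).Qv ∘ₗ ((tsV1 hc Λ' w).Δj + (1 * ((L : ℝ) ^ j) ^ (d + 1)) • (LinearMap.id : UBond (⟨d + 1, L, m, K, hd, hL⟩ : Params) j →ₗ[ℝ] UBond (⟨d + 1, L, m, K, hd, hL⟩ : Params) j)) ∘ₗ (tsV1 hc Λ' w).Ct ∘ₗ LinearMap.adjoint (tsV1 hc Λ' w).Hj : BondSpace (⟨d + 1, L, m, K, hd, hL⟩ : Params) →ₗ[ℝ]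 BondSpace (⟨d + 1, L, m, K, hd, hL⟩ : Params))) (fun b₀ : PBond (⟨d + 1, L, m, K, hd, hL⟩ : Params) 0 => iterBlockOf j b₀.src) (fun b₀ : PBond (⟨d + 1, L, m, K, hd, hL⟩ : Params) 0 => iterBlockOf j b₀.src) hC₇ le_rfl h07 (hR0 m K j hc hj Λ' w hw0 hw1 hw')
  have b8 := l2blk_mono hρ ((tsV1 hc Λ' w).Gt + (tsV1 hc Λ' w).Hj ∘ₗ (tsV1 hc Λ' w).Ct ∘ₗ LinearMap.adjoint (tsV1 hc Λ' w).Hj) (fun b₀ : PBond (⟨d + 1, L, m, K, hd, hL⟩ : Params) 0 => iterBlockOf j b₀.src) (fun b₀ : PBond (⟨d + 1, L, m, K, hd, hL⟩ : Params) 0 => iterBlockOf j b₀.src) hC₈ le_rfl h08 (hM m K j hc hj Λ' w hw0 hw1)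
  have b9 := l2blk_mono hρ (((((L : ℝ) ^ j) • (onE (LinearMap.funLeft ℝ ℝ (fun b : PBond (⟨d + 1, L, m, K, hd, hL⟩ : Params) 0 => (⟨b.src.shift lam, b.dir⟩ : PBond (⟨d + 1, L, m, K, hd, hL⟩ : Params) 0))) - LinearMap.id) : BondSpace (⟨d + 1, L, m, K, hd, hL⟩ : Params) →ₗ[ℝ] BondSpace (⟨d + 1, L, m, K, hd, hL⟩ : Params))) ∘ₗ LinearMap.adjoint (tsV1 hc Λ' w).K2) (fun b₀ : PBond (⟨d + 1, L, m, K, hd, hL⟩ : Params) 0 => iterBlockOf j b₀.src) (fun b₀ : PBond (⟨d + 1, L, m, K, hd, hL⟩ : Params) 0 => iterBlockOf j b₀.src) hC₉ le_rfl h09 (hDK2 m K j hc hj Λ' w hw lam)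
  have b0 := l2blk_mono hρ ((tsV1 hc Λ' w).K2 ∘ₗ ((((L : ℝ) ^ j) • (onE (LinearMap.funLeft ℝ ℝ (fun b : PBond (⟨d + 1, L, m, K, hd, hL⟩ : Params) 0 => (⟨b.src.unshift mu, b.dir⟩ : PBond (⟨d + 1, L, m, K, hd, hL⟩ : Params) 0))) - LinearMap.id) : BondSpace (⟨d + 1, L, m, K, hd, hL⟩ : Params) →ₗ[ℝ] BondSpace (⟨d + 1, L, m, K, hd, hL⟩ : Params)))) (fun b₀ : PBond (⟨d + 1, L, m, K, hd, hL⟩ : Params) 0 => iterBlockOf j b₀.src) (fun b₀ : PBond (⟨d + 1, L, m, K, hd, hL⟩ : Params) 0 => iterBlockOf j b₀.src) hC₀ le_rfl h00 (hK2D m K j hc hj Λ' w hw mu)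
  -- (b) the compositions
  have bT3 := l2blk_comp hρ hK (((((L : ℝ) ^ j) • (onE (LinearMap.funLeft ℝ ℝ (fun b : PBond (⟨d + 1, L, m, K, hd, hL⟩ : Params) 0 => (⟨b.src.shift lam, b.dir⟩ : PBond (⟨d + 1, L, m, K, hd, hL⟩ : Params) 0))) - LinearMap.id) : BondSpace (⟨d + 1, L, m, K, hd, hL⟩ : Params) →ₗ[ℝ] BondSpace (⟨d + 1, L, m, K, hd, hL⟩ : Params))) ∘ₗ (tsV1 hc Λ' w).Hj ∘ₗ (tsV1 hc Λ' w).Qv) ((GE (Domains.whole (P := (⟨d + 1, L, m, K, hd, hL⟩ : Params)) j (Nat.le_of_succ_le hj)) hc (w := fun _ => 1 * ((L : ℝ) ^ j) ^ (d + 1)) (fun _ => hw')) ∘ₗ ((((L : ℝ) ^ j) • (onE (LinearMap.funLeft ℝ ℝ (fun b : PBond (⟨d + 1, L, m, K, hd, hL⟩ : Params) 0 => (⟨b.src.unshift mu, b.dir⟩ : PBond (⟨d + 1, L, m, K, hd, hL⟩ : Params) 0))) - LinearMap.id) : BondSpace (⟨d + 1, L, m, K, hd, hL⟩ : Params) →ₗ[ℝ]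 BondSpace (⟨d + 1, L, m, K, hd, hL⟩ : Params)))) (fun b₀ : PBond (⟨d + 1, L, m, K, hd, hL⟩ : Params) 0 => iterBlockOf j b₀.src) (fun b₀ : PBond (⟨d + 1, L, m, K, hd, hL⟩ : Params) 0 => iterBlockOf j b₀.src) (fun b₀ : PBond (⟨d + 1, L, m, K, hd, hL⟩ : Params) 0 => iterBlockOf j b₀.src) (Cf := C₃) (Cg := C₆) (a := δ₀) (b := δ₀) (δ' := δ₀ / 2) hC₃ hC₆
    (show (0 : ℝ) ≤ δ₀ / 2 by positivity) (show δ₀ / 2 ≤ δ₀ by linarith) (show δ₀ / 2 < δ₀ by linarith) b3 b6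
  have bDMl := l2blk_comp hρ hK (((((L : ℝ) ^ j) • (onE (LinearMap.funLeft ℝ ℝ (fun b : PBond (⟨d + 1, L, m, K, hd, hL⟩ : Params) 0 => (⟨b.src.shift lam, b.dir⟩ : PBond (⟨d + 1, L, m, K, hd, hL⟩ : Params) 0))) - LinearMap.id) : BondSpace (⟨d + 1, L, m, K, hd, hL⟩ : Params) →ₗ[ℝ] BondSpace (⟨d + 1, L, m, K, hd, hL⟩ : Params))) ∘ₗ (GE (Domains.whole (P := (⟨d + 1, L, m, K, hd, hL⟩ : Params)) j (Nat.le_of_succ_le hj)) hc (w := fun _ => 1 * ((L : ℝ) ^ j) ^ (d + 1)) (fun _ => hw'))) ((LinearMap.id - LinearMap.adjoint (tsV1 hc Λ' w).Qv ∘ₗ ((tsV1 hc Λ' w).Δj + (1 * ((L : ℝ) ^ j) ^ (d + 1)) • (LinearMap.id : UBond (⟨d + 1, L, m, K, hd, hL⟩ : Params) j →ₗ[ℝ] UBond (⟨d + 1, L, m, K, hd, hL⟩ : Params) j)) ∘ₗ (tsV1 hc Λ' w).Qv ∘ₗ (GE (Domains.whole (P := (⟨d + 1, L, m, K, hd, hL⟩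 : Params)) j (Nat.le_of_succ_le hj)) hc (w := fun _ => 1 * ((L : ℝ) ^ j) ^ (d + 1)) (fun _ => hw')) + LinearMap.adjoint (tsV1 hc Λ' w).Qv ∘ₗ ((tsV1 hc Λ' w).Δj + (1 * ((L : ℝ) ^ j) ^ (d + 1)) • (LinearMap.id : UBond (⟨d + 1, L, m, K, hd, hL⟩ : Params) j →ₗ[ℝ] UBond (⟨d + 1, L, m, K, hd, hL⟩ : Params) j)) ∘ₗ (tsV1 hc Λ' w).Ct ∘ₗ LinearMap.adjoint (tsV1 hc Λ' w).Hj : BondSpace (⟨d + 1, L, m, K, hd, hL⟩ : Params) →ₗ[ℝ] BondSpace (⟨d + 1, L, m, K, hd, hL⟩ : Params))) (fun b₀ : PBond (⟨d + 1, L, m, K, hd, hL⟩ : Params) 0 => iterBlockOf j b₀.src) (fun b₀ : PBond (⟨d + 1, L, m, K, hd, hL⟩ : Params) 0 => iterBlockOf j b₀.src) (fun b₀ : PBond (⟨d + 1, L, m, K, hd, hL⟩ : Params) 0 => iterBlockOf j b₀.src) (Cf := C₅) (Cg := C₇) (a := δ₀) (b := δ₀) (δ' := δ₀ / 2) hC₅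 hC₇
    (show (0 : ℝ) ≤ δ₀ / 2 by positivity) (show δ₀ / 2 ≤ δ₀ by linarith) (show δ₀ / 2 < δ₀ by linarith) b5l b7
  have bDMm := l2blk_comp hρ hK (((((L : ℝ) ^ j) • (onE (LinearMap.funLeft ℝ ℝ (fun b : PBond (⟨d + 1, L, m, K, hd, hL⟩ : Params) 0 => (⟨b.src.shift mu, b.dir⟩ : PBond (⟨d + 1, L, m, K, hd, hL⟩ : Params) 0))) - LinearMap.id) : BondSpace (⟨d + 1, L, m, K, hd, hL⟩ : Params) →ₗ[ℝ] BondSpace (⟨d + 1, L, m, K, hd, hL⟩ : Params))) ∘ₗ (GE (Domains.whole (P := (⟨d + 1, L, m, K, hd, hL⟩ : Params)) j (Nat.le_of_succ_le hj)) hc (w := fun _ => 1 * ((L : ℝ) ^ j) ^ (d + 1)) (fun _ => hw'))) ((LinearMap.id - LinearMap.adjoint (tsV1 hc Λ' w).Qv ∘ₗ ((tsV1 hc Λ' w).Δj + (1 * ((L : ℝ) ^ j) ^ (d + 1)) • (LinearMap.id : UBond (⟨d + 1, L, m, K, hd, hL⟩ : Params) j →ₗ[ℝ] UBond (⟨d +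 1, L, m, K, hd, hL⟩ : Params) j)) ∘ₗ (tsV1 hc Λ' w).Qv ∘ₗ (GE (Domains.whole (P := (⟨d + 1, L, m, K, hd, hL⟩ : Params)) j (Nat.le_of_succ_le hj)) hc (w := fun _ => 1 * ((L : ℝ) ^ j) ^ (d + 1)) (fun _ => hw')) + LinearMap.adjoint (tsV1 hc Λ' w).Qv ∘ₗ ((tsV1 hc Λ' w).Δj + (1 * ((L : ℝ) ^ j) ^ (d + 1)) • (LinearMap.id : UBond (⟨d + 1, L, m, K, hd, hL⟩ : Params) j →ₗ[ℝ] UBond (⟨d + 1, L, m, K, hd, hL⟩ : Params) j)) ∘ₗ (tsV1 hc Λ' w).Ct ∘ₗ LinearMap.adjoint (tsV1 hc Λ' w).Hj : BondSpace (⟨d + 1, L, m, K, hd, hL⟩ : Params) →ₗ[ℝ] BondSpace (⟨d + 1, L, m, K, hd, hL⟩ : Params))) (fun b₀ : PBond (⟨d + 1, L, m, K, hd, hL⟩ : Params) 0 => iterBlockOf j b₀.src) (fun b₀ : PBond (⟨d + 1, L, m, K, hd, hL⟩ : Params) 0 => iterBlockOf j b₀.src) (fun b₀ : PBond (⟨d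 + 1, L, m, K, hd, hL⟩ : Params) 0 => iterBlockOf j b₀.src) (Cf := C₅) (Cg := C₇) (a := δ₀) (b := δ₀) (δ' := δ₀ / 2) hC₅ hC₇
    (show (0 : ℝ) ≤ δ₀ / 2 by positivity) (show δ₀ / 2 ≤ δ₀ by linarith) (show δ₀ / 2 < δ₀ by linarith) b5m b7
  rw [← DM_eq hc hj Λ' hw hw' mu] at bDMm
  have bMD := l2blk_adjoint hρ (((((L : ℝ) ^ j) • (onE (LinearMap.funLeft ℝ ℝ (fun b : PBond (⟨d + 1, L, m, K, hd, hL⟩ : Params) 0 => (⟨b.src.shift mu, b.dir⟩ : PBond (⟨d + 1, L, m, K, hd, hL⟩ : Params) 0))) - LinearMap.id) : BondSpace (⟨d + 1, L, m, K, hd, hL⟩ : Params) →ₗ[ℝ] BondSpace (⟨d + 1, L, m, K, hd, hL⟩ : Params))) ∘ₗ ((tsV1 hc Λ' w).Gt + (tsV1 hc Λ' w).Hj ∘ₗ (tsV1 hc Λ' w).Ct ∘ₗ LinearMap.adjoint (tsV1 hc Λ' w).Hj)) (fun b₀ : PBond (⟨d + 1, L, m, K, hd, hL⟩ : Params) 0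 => iterBlockOf j b₀.src) (fun b₀ : PBond (⟨d + 1, L, m, K, hd, hL⟩ : Params) 0 => iterBlockOf j b₀.src) bDMm
  rw [← MDadj_eq hc hj Λ' hw mu] at bMD
  have bT5 := l2blk_comp hρ hK ((((((L : ℝ) ^ j) • (onE (LinearMap.funLeft ℝ ℝ (fun b : PBond (⟨d + 1, L, m, K, hd, hL⟩ : Params) 0 => (⟨b.src.shift lam, b.dir⟩ : PBond (⟨d + 1, L, m, K, hd, hL⟩ : Params) 0))) - LinearMap.id) : BondSpace (⟨d + 1, L, m, K, hd, hL⟩ : Params) →ₗ[ℝ] BondSpace (⟨d + 1, L, m, K, hd, hL⟩ : Params))) ∘ₗ (GE (Domains.whole (P := (⟨d + 1, L, m, K, hd, hL⟩ : Params)) j (Nat.le_of_succ_le hj)) hc (w := fun _ => 1 * ((L : ℝ) ^ j) ^ (d + 1)) (fun _ => hw'))) ∘ₗ ((LinearMap.id - LinearMap.adjoint (tsV1 hc Λ' w).Qv ∘ₗ ((tsV1 hc Λ' w).Δj + (1 * ((L : ℝ) ^ j) ^ (d + 1)) • (LinearMap.id : UBond (⟨d + 1, L, m, K, hd, hL⟩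 : Params) j →ₗ[ℝ] UBond (⟨d + 1, L, m, K, hd, hL⟩ : Params) j)) ∘ₗ (tsV1 hc Λ' w).Qv ∘ₗ (GE (Domains.whole (P := (⟨d + 1, L, m, K, hd, hL⟩ : Params)) j (Nat.le_of_succ_le hj)) hc (w := fun _ => 1 * ((L : ℝ) ^ j) ^ (d + 1)) (fun _ => hw')) + LinearMap.adjoint (tsV1 hc Λ' w).Qv ∘ₗ ((tsV1 hc Λ' w).Δj + (1 * ((L : ℝ) ^ j) ^ (d + 1)) • (LinearMap.id : UBond (⟨d + 1, L, m, K, hd, hL⟩ : Params) j →ₗ[ℝ] UBond (⟨d + 1, L, m, K, hd, hL⟩ : Params) j)) ∘ₗ (tsV1 hc Λ' w).Ct ∘ₗ LinearMap.adjoint (tsV1 hc Λ' w).Hj : BondSpace (⟨d + 1, L, m, K, hd, hL⟩ : Params) →ₗ[ℝ] BondSpace (⟨d + 1, L, m, K, hd, hL⟩ : Params)))) ((tsV1 hc Λ' w).K2 ∘ₗ ((((L : ℝ) ^ j) • (onE (LinearMap.funLeft ℝ ℝ (fun b : PBond (⟨d + 1, L, m, K, hd, hL⟩ : Params) 0 =>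 (⟨b.src.unshift mu, b.dir⟩ : PBond (⟨d + 1, L, m, K, hd, hL⟩ : Params) 0))) - LinearMap.id) : BondSpace (⟨d + 1, L, m, K, hd, hL⟩ : Params) →ₗ[ℝ] BondSpace (⟨d + 1, L, m, K, hd, hL⟩ : Params)))) (fun b₀ : PBond (⟨d + 1, L, m, K, hd, hL⟩ : Params) 0 => iterBlockOf j b₀.src) (fun b₀ : PBond (⟨d + 1, L, m, K, hd, hL⟩ : Params) 0 => iterBlockOf j b₀.src) (fun b₀ : PBond (⟨d + 1, L, m, K, hd, hL⟩ : Params) 0 => iterBlockOf j b₀.src) (Cf := C₅ * C₇ * Ka) (Cg := C₀) (a := δ₀ / 2) (b := δ₀) (δ' := δ₀ / 4)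
    (by positivity) hC₀ (show (0 : ℝ) ≤ δ₀ / 4 by positivity) (show δ₀ / 4 ≤ δ₀ by linarith) (show δ₀ / 4 < δ₀ / 2 by linarith) bDMl b0
  have bT6 := l2blk_comp hρ hK (((((L : ℝ) ^ j) • (onE (LinearMap.funLeft ℝ ℝ (fun b : PBond (⟨d + 1, L, m, K, hd, hL⟩ : Params) 0 => (⟨b.src.shift lam, b.dir⟩ : PBond (⟨d + 1, L, m, K, hd, hL⟩ : Params) 0))) - LinearMap.id) : BondSpace (⟨d + 1, L, m, K, hd, hL⟩ : Params) →ₗ[ℝ] BondSpace (⟨d + 1, L, m, K, hd, hL⟩ : Params))) ∘ₗ LinearMap.adjoint (tsV1 hc Λ' w).K2) (((tsV1 hc Λ' w).Gt + (tsV1 hc Λ' w).Hj ∘ₗ (tsV1 hc Λ' w).Ct ∘ₗ LinearMap.adjoint (tsV1 hc Λ' w).Hj) ∘ₗ ((((L : ℝ) ^ j) • (onE (LinearMap.funLeft ℝ ℝ (fun b : PBond (⟨d + 1, L, m, K, hd, hL⟩ : Params) 0 => (⟨b.src.unshift mu, b.dir⟩ : PBond (⟨d + 1, L, m, K, hd,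 hL⟩ : Params) 0))) - LinearMap.id) : BondSpace (⟨d + 1, L, m, K, hd, hL⟩ : Params) →ₗ[ℝ] BondSpace (⟨d + 1, L, m, K, hd, hL⟩ : Params)))) (fun b₀ : PBond (⟨d + 1, L, m, K, hd, hL⟩ : Params) 0 => iterBlockOf j b₀.src) (fun b₀ : PBond (⟨d + 1, L, m, K, hd, hL⟩ : Params) 0 => iterBlockOf j b₀.src) (fun b₀ : PBond (⟨d + 1, L, m, K, hd, hL⟩ : Params) 0 => iterBlockOf j b₀.src) (Cf := C₉) (Cg := C₅ * C₇ * Ka) (a := δ₀) (b := δ₀ / 2) (δ' := δ₀ / 4)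
    hC₉ (by positivity) (show (0 : ℝ) ≤ δ₀ / 4 by positivity) (show δ₀ / 4 ≤ δ₀ / 2 by linarith) (show δ₀ / 4 < δ₀ by linarith) b9 bMD
  have bMK := l2blk_comp hρ hK ((tsV1 hc Λ' w).Gt + (tsV1 hc Λ' w).Hj ∘ₗ (tsV1 hc Λ' w).Ct ∘ₗ LinearMap.adjoint (tsV1 hc Λ' w).Hj) ((tsV1 hc Λ' w).K2 ∘ₗ ((((L : ℝ) ^ j) • (onE (LinearMap.funLeft ℝ ℝ (fun b : PBond (⟨d + 1, L, m, K, hd, hL⟩ : Params) 0 => (⟨b.src.unshift mu, b.dir⟩ : PBond (⟨d + 1, L, m, K, hd, hL⟩ : Params) 0))) - LinearMap.id) : BondSpace (⟨d + 1, L, m, K, hd, hL⟩ : Params) →ₗ[ℝ] BondSpace (⟨d + 1, L, m, K, hd, hL⟩ : Params)))) (fun b₀ : PBond (⟨d + 1, L, m, K, hd, hL⟩ : Params) 0 => iterBlockOf j b₀.src) (fun b₀ : PBond (⟨d + 1, L, m, K, hd, hL⟩ : Params) 0 => iterBlockOf j b₀.src) (fun b₀ : PBond (⟨d + 1, L, m,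 K, hd, hL⟩ : Params) 0 => iterBlockOf j b₀.src) (Cf := C₈) (Cg := C₀) (a := δ₀) (b := δ₀) (δ' := δ₀ / 2) hC₈ hC₀
    (show (0 : ℝ) ≤ δ₀ / 2 by positivity) (show δ₀ / 2 ≤ δ₀ by linarith) (show δ₀ / 2 < δ₀ by linarith) b8 b0
  have bT7 := l2blk_comp hρ hK (((((L : ℝ) ^ j) • (onE (LinearMap.funLeft ℝ ℝ (fun b : PBond (⟨d + 1, L, m, K, hd, hL⟩ : Params) 0 => (⟨b.src.shift lam, b.dir⟩ : PBond (⟨d + 1, L, m, K, hd, hL⟩ : Params) 0))) - LinearMap.id) : BondSpace (⟨d + 1, L, m, K, hd, hL⟩ : Params) →ₗ[ℝ] BondSpace (⟨d + 1, L, m, K, hd, hL⟩ : Params))) ∘ₗ LinearMap.adjoint (tsV1 hc Λ' w).K2) (((tsV1 hc Λ' w).Gt + (tsV1 hc Λ' w).Hj ∘ₗ (tsV1 hc Λ' w).Ct ∘ₗ LinearMap.adjoint (tsV1 hc Λ' w).Hj) ∘ₗ ((tsV1 hc Λ' w).K2 ∘ₗ ((((L : ℝ) ^ j) • (onE (LinearMap.funLeft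 ℝ ℝ (fun b : PBond (⟨d + 1, L, m, K, hd, hL⟩ : Params) 0 => (⟨b.src.unshift mu, b.dir⟩ : PBond (⟨d + 1, L, m, K, hd, hL⟩ : Params) 0))) - LinearMap.id) : BondSpace (⟨d + 1, L, m, K, hd, hL⟩ : Params) →ₗ[ℝ] BondSpace (⟨d + 1, L, m, K, hd, hL⟩ : Params))))) (fun b₀ : PBond (⟨d + 1, L, m, K, hd, hL⟩ : Params) 0 => iterBlockOf j b₀.src) (fun b₀ : PBond (⟨d + 1, L, m, K, hd, hL⟩ : Params) 0 => iterBlockOf j b₀.src) (fun b₀ : PBond (⟨d + 1, L, m, K, hd, hL⟩ : Params) 0 => iterBlockOf j b₀.src) (Cf := C₉) (Cg := C₈ * C₀ * Ka) (a := δ₀) (b := δ₀ / 2) (δ' := δ₀ / 4)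
    hC₉ (by positivity) (show (0 : ℝ) ≤ δ₀ / 4 by positivity) (show δ₀ / 4 ≤ δ₀ / 2 by linarith) (show δ₀ / 4 < δ₀ by linarith) b9 bMK
  -- (c) everything at the final rate `δ₀/4`, and the sum
  have c1 := l2blk_mono hρ (((((L : ℝ) ^ j) • (onE (LinearMap.funLeft ℝ ℝ (fun b : PBond (⟨d + 1, L, m, K, hd, hL⟩ : Params) 0 => (⟨b.src.shift lam, b.dir⟩ : PBond (⟨d + 1, L, m, K, hd, hL⟩ : Params) 0))) - LinearMap.id) : BondSpace (⟨d + 1, L, m, K, hd, hL⟩ : Params) →ₗ[ℝ] BondSpace (⟨d + 1, L, m, K, hd, hL⟩ : Params))) ∘ₗ (tsV1 hc Λ' w).K1 ∘ₗ ((((L : ℝ) ^ j) • (onE (LinearMap.funLeft ℝ ℝ (fun b : PBond (⟨d + 1, L, m, K, hd, hL⟩ : Params) 0 => (⟨b.src.unshift mu, b.dir⟩ : PBond (⟨d + 1, L, m, K, hd, hL⟩ : Params) 0))) - LinearMap.id) : BondSpace (⟨d + 1, L, m, K, hd, hL⟩ : Params) →ₗ[ℝ] BondSpace (⟨d + 1,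 L, m, K, hd, hL⟩ : Params)))) (fun b₀ : PBond (⟨d + 1, L, m, K, hd, hL⟩ : Params) 0 => iterBlockOf j b₀.src) (fun b₀ : PBond (⟨d + 1, L, m, K, hd, hL⟩ : Params) 0 => iterBlockOf j b₀.src) hC₁ le_rfl (show δ₀ / 4 ≤ δ₀ by linarith) b1
  have c2 := l2blk_mono hρ (((((L : ℝ) ^ j) • (onE (LinearMap.funLeft ℝ ℝ (fun b : PBond (⟨d + 1, L, m, K, hd, hL⟩ : Params) 0 => (⟨b.src.shift lam, b.dir⟩ : PBond (⟨d + 1, L, m, K, hd, hL⟩ : Params) 0))) - LinearMap.id) : BondSpace (⟨d + 1, L, m, K, hd, hL⟩ : Params) →ₗ[ℝ] BondSpace (⟨d + 1, L, m, K, hd, hL⟩ : Params))) ∘ₗ (GE (Domains.whole (P := (⟨d + 1, L, m, K, hd, hL⟩ : Params)) j (Nat.le_of_succ_le hj)) hc (w := fun _ => 1 * ((L : ℝ) ^ j) ^ (d + 1)) (fun _ => hw')) ∘ₗ ((((L : ℝ) ^ j) • (onE (LinearMap.funLeft ℝ ℝ (fun b : PBond (⟨d + 1, L, m, K, hd, hL⟩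 : Params) 0 => (⟨b.src.unshift mu, b.dir⟩ : PBond (⟨d + 1, L, m, K, hd, hL⟩ : Params) 0))) - LinearMap.id) : BondSpace (⟨d + 1, L, m, K, hd, hL⟩ : Params) →ₗ[ℝ] BondSpace (⟨d + 1, L, m, K, hd, hL⟩ : Params)))) (fun b₀ : PBond (⟨d + 1, L, m, K, hd, hL⟩ : Params) 0 => iterBlockOf j b₀.src) (fun b₀ : PBond (⟨d + 1, L, m, K, hd, hL⟩ : Params) 0 => iterBlockOf j b₀.src) hC₂ le_rfl (show δ₀ / 4 ≤ δ₀ by linarith) b2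
  have c3 := l2blk_mono hρ ((((((L : ℝ) ^ j) • (onE (LinearMap.funLeft ℝ ℝ (fun b : PBond (⟨d + 1, L, m, K, hd, hL⟩ : Params) 0 => (⟨b.src.shift lam, b.dir⟩ : PBond (⟨d + 1, L, m, K, hd, hL⟩ : Params) 0))) - LinearMap.id) : BondSpace (⟨d + 1, L, m, K, hd, hL⟩ : Params) →ₗ[ℝ] BondSpace (⟨d + 1, L, m, K, hd, hL⟩ : Params))) ∘ₗ (tsV1 hc Λ' w).Hj ∘ₗ (tsV1 hc Λ' w).Qv) ∘ₗ ((GE (Domains.whole (P := (⟨d + 1, L, m, K, hd, hL⟩ : Params)) j (Nat.le_of_succ_le hj)) hc (w := fun _ => 1 * ((L : ℝ) ^ j) ^ (d + 1)) (fun _ => hw')) ∘ₗ ((((L : ℝ) ^ j) • (onE (LinearMap.funLeft ℝ ℝ (fun b : PBond (⟨d + 1, L, m, K, hd, hL⟩ : Params) 0 => (⟨b.src.unshift mu, b.dir⟩ : PBond (⟨d + 1, L, m, K, hd, hL⟩ : Params) 0))) - LinearMap.id) : BondSpace (⟨d + 1, L, m, K, hd, hL⟩ : Params) →ₗ[ℝ]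 BondSpace (⟨d + 1, L, m, K, hd, hL⟩ : Params))))) (fun b₀ : PBond (⟨d + 1, L, m, K, hd, hL⟩ : Params) 0 => iterBlockOf j b₀.src) (fun b₀ : PBond (⟨d + 1, L, m, K, hd, hL⟩ : Params) 0 => iterBlockOf j b₀.src) (C' := C₃ * C₆ * Ka) (by positivity) le_rfl (show δ₀ / 4 ≤ δ₀ / 2 by linarith) bT3
  have c4 := l2blk_mono hρ (((((L : ℝ) ^ j) • (onE (LinearMap.funLeft ℝ ℝ (fun b : PBond (⟨d + 1, L, m, K, hd, hL⟩ : Params) 0 => (⟨b.src.shift lam, b.dir⟩ : PBond (⟨d + 1, L, m, K, hd, hL⟩ : Params) 0))) - LinearMap.id) : BondSpace (⟨d + 1, L, m, K, hd, hL⟩ : Params) →ₗ[ℝ] BondSpace (⟨d + 1, L, m, K, hd, hL⟩ : Params))) ∘ₗ (tsV1 hc Λ' w).Hj ∘ₗ (tsV1 hc Λ' w).Ct ∘ₗ LinearMap.adjoint (tsV1 hc Λ' w).Hj ∘ₗ ((((L : ℝ) ^ j) • (onE (LinearMap.funLeft ℝ ℝ (fun b : PBond (⟨d + 1, L, m, K,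 hd, hL⟩ : Params) 0 => (⟨b.src.unshift mu, b.dir⟩ : PBond (⟨d + 1, L, m, K, hd, hL⟩ : Params) 0))) - LinearMap.id) : BondSpace (⟨d + 1, L, m, K, hd, hL⟩ : Params) →ₗ[ℝ] BondSpace (⟨d + 1, L, m, K, hd, hL⟩ : Params)))) (fun b₀ : PBond (⟨d + 1, L, m, K, hd, hL⟩ : Params) 0 => iterBlockOf j b₀.src) (fun b₀ : PBond (⟨d + 1, L, m, K, hd, hL⟩ : Params) 0 => iterBlockOf j b₀.src) hC₄ le_rfl (show δ₀ / 4 ≤ δ₀ by linarith) b4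
  have s23 := l2blk_sub (ρ := (fun t t' : Site (⟨d + 1, L, m, K, hd, hL⟩ : Params) j => torusSupNorm (Mk (⟨d + 1, L, m, K, hd, hL⟩ : Params) j) (rep (Mk (⟨d + 1, L, m, K, hd, hL⟩ : Params) j) t - rep (Mk (⟨d + 1, L, m, K, hd, hL⟩ : Params) j) t'))) _ _ (fun b₀ : PBond (⟨d + 1, L, m, K, hd, hL⟩ : Params) 0 => iterBlockOf j b₀.src) (fun b₀ : PBond (⟨d + 1, L, m, K, hd, hL⟩ : Params) 0 => iterBlockOf j b₀.src) c2 c3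
  have s234 := l2blk_add (ρ := (fun t t' : Site (⟨d + 1, L, m, K, hd, hL⟩ : Params) j => torusSupNorm (Mk (⟨d + 1, L, m, K, hd, hL⟩ : Params) j) (rep (Mk (⟨d + 1, L, m, K, hd, hL⟩ : Params) j) t - rep (Mk (⟨d + 1, L, m, K, hd, hL⟩ : Params) j) t'))) _ _ (fun b₀ : PBond (⟨d + 1, L, m, K, hd, hL⟩ : Params) 0 => iterBlockOf j b₀.src) (fun b₀ : PBond (⟨d + 1, L, m, K, hd, hL⟩ : Params) 0 => iterBlockOf j b₀.src) s23 c4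
  have s1234 := l2blk_add (ρ := (fun t t' : Site (⟨d + 1, L, m, K, hd, hL⟩ : Params) j => torusSupNorm (Mk (⟨d + 1, L, m, K, hd, hL⟩ : Params) j) (rep (Mk (⟨d + 1, L, m, K, hd, hL⟩ : Params) j) t - rep (Mk (⟨d + 1, L, m, K, hd, hL⟩ : Params) j) t'))) _ _ (fun b₀ : PBond (⟨d + 1, L, m, K, hd, hL⟩ : Params) 0 => iterBlockOf j b₀.src) (fun b₀ : PBond (⟨d + 1, L, m, K, hd, hL⟩ : Params) 0 => iterBlockOf j b₀.src) c1 s234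
  have s5 := l2blk_sub (ρ := (fun t t' : Site (⟨d + 1, L, m, K, hd, hL⟩ : Params) j => torusSupNorm (Mk (⟨d + 1, L, m, K, hd, hL⟩ : Params) j) (rep (Mk (⟨d + 1, L, m, K, hd, hL⟩ : Params) j) t - rep (Mk (⟨d + 1, L, m, K, hd, hL⟩ : Params) j) t'))) _ _ (fun b₀ : PBond (⟨d + 1, L, m, K, hd, hL⟩ : Params) 0 => iterBlockOf j b₀.src) (fun b₀ : PBond (⟨d + 1, L, m, K, hd, hL⟩ : Params) 0 => iterBlockOf j b₀.src) s1234 bT5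
  have s6 := l2blk_sub (ρ := (fun t t' : Site (⟨d + 1, L, m, K, hd, hL⟩ : Params) j => torusSupNorm (Mk (⟨d + 1, L, m, K, hd, hL⟩ : Params) j) (rep (Mk (⟨d + 1, L, m, K, hd, hL⟩ : Params) j) t - rep (Mk (⟨d + 1, L, m, K, hd, hL⟩ : Params) j) t'))) _ _ (fun b₀ : PBond (⟨d + 1, L, m, K, hd, hL⟩ : Params) 0 => iterBlockOf j b₀.src) (fun b₀ : PBond (⟨d + 1, L, m, K, hd, hL⟩ : Params) 0 => iterBlockOf j b₀.src) s5 bT6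
  have s7 := l2blk_add (ρ := (fun t t' : Site (⟨d + 1, L, m, K, hd, hL⟩ : Params) j => torusSupNorm (Mk (⟨d + 1, L, m, K, hd, hL⟩ : Params) j) (rep (Mk (⟨d + 1, L, m, K, hd, hL⟩ : Params) j) t - rep (Mk (⟨d + 1, L, m, K, hd, hL⟩ : Params) j) t'))) _ _ (fun b₀ : PBond (⟨d + 1, L, m, K, hd, hL⟩ : Params) 0 => iterBlockOf j b₀.src) (fun b₀ : PBond (⟨d + 1, L, m, K, hd, hL⟩ : Params) 0 => iterBlockOf j b₀.src) s6 bT7 y y' v u hv hu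
  rw [DGD_eq hc hj Λ' hw hw' lam mu]
  refine s7.trans (le_of_eq ?_)
  rw [hC, hKa, hKb, hKc]

/-! ## §3  The printed shape: the member `‖ζ∇G∇*J‖` of (1.114) for the two-scale `G` -/

open Classical in
/-- **PROPOSITION 2.5, THE MEMBER `‖ζ∇_λG∇_μ*J‖` OF (1.114) IN THE PRINTED SHAPE** for the genuine two-scale `G` of (2.90), `Λ′` arbitrary (at
`c = L^j`, weights `a₀n^{d+1} ≤ w ≤ a₁n^{d+1}`): there are `δ₂ > 0`, `C ≥ 0` depending on `d, L, a₀, a₁` only such that for every volume,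
`j + 1 ≤ m + K`, `Λ′`, weights in the window, directions `λ, μ`, every radius `r ≥ 0`, every fine bond field `J` supported on the fine bonds over the
unit sites within `r` of `y′`, every cut-off `ζ` on the fine sites supported over the unit sites within `r` of `y` with `|ζ| ≤ Z`:
`Σ_{b₀}(ζ(b₀₋)·(∇_λG∇_μ*J)(b₀))² ≤ (C·e^{(1+2δ₂)r}·e^{−δ₂|y − y′|_T}·Z)²·‖J‖²`, i.e. `‖ζ∇_λG∇_μ*J‖ ≤ C e^{(1+2δ₂)r}e^{−δ₂|y−y′|}|ζ|‖J‖` (`r = 1`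
contains [4]'s cubes `Δ̃`). [cite: Balaban1984PropagatorsII, Prop. 2.5 p.246; Balaban1984PropagatorsI, Prop. 1.2 (1.114) p.36] -/
theorem prop25_ineq114_gradGdiv (d L : ℕ) (hd : 1 ≤ d + 1) (hL : Odd L ∧ 1 < L) {a₀ a₁ : ℝ} (ha₀ : 0 < a₀) (ha₁ : a₀ ≤ a₁) :
    ∃ δ : ℝ, 0 < δ ∧ ∃ C : ℝ, 0 ≤ C ∧ ∀ (m K : ℕ) (j : ℕ) (hc : ((L : ℝ) ^ j) ≠ 0)
      (_hj : j + 1 ≤ (⟨d + 1, L, m, K, hd, hL⟩ : Params).m + (⟨d + 1, L, m, K, hd, hL⟩ : Params).K)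
      (Λ' : Finset (Site (⟨d + 1, L, m, K, hd, hL⟩ : Params) (j + 1))) (w : CIdx j Λ' → ℝ)
      (_hw0 : ∀ i, a₀ * ((L : ℝ) ^ j) ^ (d + 1) ≤ w i) (_hw1 : ∀ i, w i ≤ a₁ * ((L : ℝ) ^ j) ^ (d + 1)) (lam mu : Fin (d + 1))
      (r : ℝ) (_hr : 0 ≤ r) (J : BondSpace (⟨d + 1, L, m, K, hd, hL⟩ : Params)) (ζ : Site (⟨d + 1, L, m, K, hd, hL⟩ : Params) 0 → ℝ) (Z : ℝ) (_hZ : 0 ≤ Z) (y y' : Site (⟨d + 1, L, m, K, hd, hL⟩ : Params) j)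
      (_hsuppJ : ∀ b : PBond (⟨d + 1, L, m, K, hd, hL⟩ : Params) 0, J b ≠ 0 → torusSupNorm (Mk (⟨d + 1, L, m, K, hd, hL⟩ : Params) j) (rep (Mk (⟨d + 1, L, m, K, hd, hL⟩ : Params) j) (iterBlockOf j b.src) - rep (Mk (⟨d + 1, L, m, K, hd, hL⟩ : Params) j) y') ≤ r)
      (_hsuppζ : ∀ x : Site (⟨d + 1, L, m, K, hd, hL⟩ : Params) 0, ζ x ≠ 0 → torusSupNorm (Mk (⟨d + 1, L, m, K, hd, hL⟩ : Params) j) (rep (Mk (⟨d + 1, L, m, K, hd, hL⟩ : Params) j) (iterBlockOf j x) - rep (Mk (⟨d + 1, L, m, K, hd, hL⟩ : Params) j) y) ≤ r)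
      (_hζ : ∀ x : Site (⟨d + 1, L, m, K, hd, hL⟩ : Params) 0, |ζ x| ≤ Z),
      ∑ b₀ : PBond (⟨d + 1, L, m, K, hd, hL⟩ : Params) 0, (ζ b₀.src * (((((L : ℝ) ^ j) • (onE (LinearMap.funLeft ℝ ℝ (fun b : PBond (⟨d + 1, L, m, K, hd, hL⟩ : Params) 0 => (⟨b.src.shift lam, b.dir⟩ : PBond (⟨d + 1, L, m, K, hd, hL⟩ : Params) 0))) - LinearMap.id) : BondSpace (⟨d + 1, L, m, K, hd, hL⟩ : Params) →ₗ[ℝ] BondSpace (⟨d + 1, L, m, K, hd, hL⟩ : Params))) ((tsV1 hc Λ' w).G (((((L : ℝ) ^ j) • (onE (LinearMap.funLeft ℝ ℝ (fun b : PBond (⟨d + 1, L, m, K, hd, hL⟩ : Params) 0 => (⟨b.src.unshift mu, b.dir⟩ : PBond (⟨d + 1, L, m, K, hd, hL⟩ : Params) 0))) - LinearMap.id) : BondSpace (⟨d + 1, L, m, K, hd, hL⟩ : Params) →ₗ[ℝ] BondSpace (⟨d + 1, L, m, K, hd, hL⟩ : Params))) J))) b₀) ^ 2 ≤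
        (C * Real.exp ((1 + 2 * δ) * r) * Real.exp (-(δ * torusSupNorm (Mk (⟨d + 1, L, m, K, hd, hL⟩ : Params) j) (rep (Mk (⟨d + 1, L, m, K, hd, hL⟩ : Params) j) y - rep (Mk (⟨d + 1, L, m, K, hd, hL⟩ : Params) j) y'))) * Z) ^ 2 * ‖J‖ ^ 2 := by
  obtain ⟨δ, hδ, C, hC, h⟩ := l2blk_DGD_scaling d L hd hL ha₀ ha₁
  refine ⟨δ, hδ, C * latticeConst (d + 1) 1, mul_nonneg hC (latticeConst_nonneg _ zero_le_one), ?_⟩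
  intro m K j hc hj Λ' w hw0 hw1 lam mu r hr J ζ Z hZ y y' hsuppJ hsuppζ hζ
  have hρ : IsPseudoDist (fun t t' : Site (⟨d + 1, L, m, K, hd, hL⟩ : Params) j => torusSupNorm (Mk (⟨d + 1, L, m, K, hd, hL⟩ : Params) j) (rep (Mk (⟨d + 1, L, m, K, hd, hL⟩ : Params) j) t - rep (Mk (⟨d + 1, L, m, K, hd, hL⟩ : Params) j) t')) := torusDist_isPseudoDist (Mk (⟨d + 1, L, m, K, hd, hL⟩ : Params) j)
  have hK : SumBound (fun t t' : Site (⟨d + 1, L, m, K, hd, hL⟩ : Params) j => torusSupNorm (Mk (⟨d + 1, L, m, K, hd, hL⟩ : Params) j) (rep (Mk (⟨d + 1, L, m, K, hd, hL⟩ : Params) j) t - rep (Mk (⟨d + 1, L, m, K, hd, hL⟩ : Params) j) t')) (fun a => latticeConst (d + 1) a) := torusDist_sumBound (Mk (⟨d + 1, L, m, K, hd, hL⟩ : Params) j)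
  have h' := normSq_cut_apply_le_of_l2blk hρ hK (((((L : ℝ) ^ j) • (onE (LinearMap.funLeft ℝ ℝ (fun b : PBond (⟨d + 1, L, m, K, hd, hL⟩ : Params) 0 => (⟨b.src.shift lam, b.dir⟩ : PBond (⟨d + 1, L, m, K, hd, hL⟩ : Params) 0))) - LinearMap.id) : BondSpace (⟨d + 1, L, m, K, hd, hL⟩ : Params) →ₗ[ℝ] BondSpace (⟨d + 1, L, m, K, hd, hL⟩ : Params))) ∘ₗ (tsV1 hc Λ' w).G ∘ₗ ((((L : ℝ) ^ j) • (onE (LinearMap.funLeft ℝ ℝ (fun b : PBond (⟨d + 1, L, m, K, hd, hL⟩ : Params) 0 => (⟨b.src.unshift mu, b.dir⟩ : PBond (⟨d + 1, L, m, K, hd, hL⟩ : Params) 0))) - LinearMap.id) : BondSpace (⟨d + 1, L, m, K, hd, hL⟩ : Params) →ₗ[ℝ] BondSpace (⟨d + 1, L, m, K, hd, hL⟩ : Params)))) (fun b₀ : PBond (⟨d + 1, L, m, K, hd, hL⟩ : Params) 0 => iterBlockOf j b₀.src) (fun b₀ : PBond (⟨d + 1, L, m, K, hd, hL⟩ : Params)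 0 => iterBlockOf j b₀.src) hC hδ.le hZ (h m K j hc hj Λ' w hw0 hw1 lam mu) J
    (fun b₀ : PBond (⟨d + 1, L, m, K, hd, hL⟩ : Params) 0 => ζ b₀.src) y y' hsuppJ (fun b₀ hb => hsuppζ b₀.src hb) (fun b₀ => hζ b₀.src)
  refine h'.trans (le_of_eq ?_)
  ring

/-! ## §4  The global member `‖∇G∇*J‖ ≤ C‖J‖` of [4] (1.89) for the two-scale `G` -/

open Classical in
/-- **[4] (1.89), THE GLOBAL MEMBER `‖∇_λG∇_μ*J‖ ≤ C‖J‖` FOR THE TWO-SCALE `G` OF (2.90)** (`c = L^j`, weights `a₀n^{d+1} ≤ w ≤ a₁n^{d+1}`): `∃ C ≥ 0`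
depending on `d, L, a₀, a₁` only such that for every volume, `j + 1 ≤ m + K`, `Λ′`, weights in the window, directions `λ, μ` and EVERY fine bond
field `J`: `‖∇_λG∇_μ*J‖ ≤ C‖J‖` (§2 summed over the blocks by file 23b's `norm_apply_le_of_l2blk`; gen 13's `B6Prop25GlobalGradL2TwoScaleV1` has the
member by the variational route). [cite: Balaban1984PropagatorsI, Prop. 1.1 (1.89) p.33; Balaban1984PropagatorsII, Prop. 2.5 p.246] -/
theorem prop25_ineq189_gradGdiv (d L : ℕ) (hd : 1 ≤ d + 1) (hL : Odd L ∧ 1 < L) {a₀ a₁ : ℝ} (ha₀ : 0 < a₀) (ha₁ : a₀ ≤ a₁) :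
    ∃ C : ℝ, 0 ≤ C ∧ ∀ (m K : ℕ) (j : ℕ) (hc : ((L : ℝ) ^ j) ≠ 0)
      (_hj : j + 1 ≤ (⟨d + 1, L, m, K, hd, hL⟩ : Params).m + (⟨d + 1, L, m, K, hd, hL⟩ : Params).K)
      (Λ' : Finset (Site (⟨d + 1, L, m, K, hd, hL⟩ : Params) (j + 1))) (w : CIdx j Λ' → ℝ)
      (_hw0 : ∀ i, a₀ * ((L : ℝ) ^ j) ^ (d + 1) ≤ w i) (_hw1 : ∀ i, w i ≤ a₁ * ((L : ℝ) ^ j) ^ (d + 1)) (lam mu : Fin (d + 1))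
      (J : BondSpace (⟨d + 1, L, m, K, hd, hL⟩ : Params)),
      ‖((((L : ℝ) ^ j) • (onE (LinearMap.funLeft ℝ ℝ (fun b : PBond (⟨d + 1, L, m, K, hd, hL⟩ : Params) 0 => (⟨b.src.shift lam, b.dir⟩ : PBond (⟨d + 1, L, m, K, hd, hL⟩ : Params) 0))) - LinearMap.id) : BondSpace (⟨d + 1, L, m, K, hd, hL⟩ : Params) →ₗ[ℝ] BondSpace (⟨d + 1, L, m, K, hd, hL⟩ : Params))) ((tsV1 hc Λ' w).G (((((L : ℝ) ^ j) • (onE (LinearMap.funLeft ℝ ℝ (fun b : PBond (⟨d + 1, L, m, K, hd, hL⟩ : Params) 0 => (⟨b.src.unshift mu, b.dir⟩ : PBond (⟨d + 1, L, m, K, hd, hL⟩ : Params) 0))) - LinearMap.id) : BondSpace (⟨d + 1, L, m, K, hd, hL⟩ : Params) →ₗ[ℝ] BondSpace (⟨d + 1, L, m, K, hd, hL⟩ : Params))) J))‖ ≤ C * ‖J‖ := by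
  obtain ⟨δ, hδ, C, hC, h⟩ := l2blk_DGD_scaling d L hd hL ha₀ ha₁
  refine ⟨C * latticeConst (d + 1) δ, mul_nonneg hC (latticeConst_nonneg _ hδ.le), ?_⟩
  intro m K j hc hj Λ' w hw0 hw1 lam mu J
  have hρ : IsPseudoDist (fun t t' : Site (⟨d + 1, L, m, K, hd, hL⟩ : Params) j => torusSupNorm (Mk (⟨d + 1, L, m, K, hd, hL⟩ : Params) j) (rep (Mk (⟨d + 1, L, m, K, hd, hL⟩ : Params) j) t - rep (Mk (⟨d + 1, L, m, K, hd, hL⟩ : Params) j) t')) := torusDist_isPseudoDist (Mk (⟨d + 1, L, m, K, hd, hL⟩ : Params) j)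
  have hK : SumBound (fun t t' : Site (⟨d + 1, L, m, K, hd, hL⟩ : Params) j => torusSupNorm (Mk (⟨d + 1, L, m, K, hd, hL⟩ : Params) j) (rep (Mk (⟨d + 1, L, m, K, hd, hL⟩ : Params) j) t - rep (Mk (⟨d + 1, L, m, K, hd, hL⟩ : Params) j) t')) (fun a => latticeConst (d + 1) a) := torusDist_sumBound (Mk (⟨d + 1, L, m, K, hd, hL⟩ : Params) j)
  exact norm_apply_le_of_l2blk hρ hK (((((L : ℝ) ^ j) • (onE (LinearMap.funLeft ℝ ℝ (fun b : PBond (⟨d + 1, L, m, K, hd, hL⟩ : Params) 0 => (⟨b.src.shift lam, b.dir⟩ : PBond (⟨d + 1, L, m, K, hd, hL⟩ : Params) 0))) - LinearMap.id) : BondSpace (⟨d + 1, L, m, K, hd, hL⟩ : Params) →ₗ[ℝ] BondSpace (⟨d + 1, L, m, K, hd, hL⟩ : Params))) ∘ₗ (tsV1 hc Λ' w).G ∘ₗ ((((L : ℝ) ^ j) • (onE (LinearMap.funLeft ℝ ℝ (fun b : PBond (⟨d + 1, L, m, K, hd, hL⟩ : Params) 0 => (⟨b.src.unshift mu, b.dir⟩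 : PBond (⟨d + 1, L, m, K, hd, hL⟩ : Params) 0))) - LinearMap.id) : BondSpace (⟨d + 1, L, m, K, hd, hL⟩ : Params) →ₗ[ℝ] BondSpace (⟨d + 1, L, m, K, hd, hL⟩ : Params)))) (fun b₀ : PBond (⟨d + 1, L, m, K, hd, hL⟩ : Params) 0 => iterBlockOf j b₀.src) (fun b₀ : PBond (⟨d + 1, L, m, K, hd, hL⟩ : Params) 0 => iterBlockOf j b₀.src) hC hδ (latticeConst_nonneg _ hδ.le) (h m K j hc hj Λ' w hw0 hw1 lam mu) J

end Literature.MathematicalPhysics.QuantumFieldTheory.Balaban1983to89.B6Prop25GradGDivDecayTwoScaleV1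

end
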